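import Literature.Topology.FourManifolds.FlowerSectorSpine
import Literature.Topology.FourManifolds.FlowerSectorEndMap
import Literature.Topology.FourManifolds.SurfaceGroupMelon
import Literature.Topology.FourManifolds.SurfaceGroupGenusOne
import Literature.AlgebraicTopology.FundamentalGroup.EdgePaths
import Mathlib.Tactic.IrreducibleDef
import HarnessLib

/-!
# The boundary word of a sector of the flower surface: `[δ₋ · δ₊⁻¹] = a b a⁻¹ b⁻¹`

Topic `Literature/Topology/FourManifolds`; the crux computation ("brick 4b") of the fact seat
`provefact-Literature.Topology.FourManifolds.exists-cbed50d78a` (named fact (g′)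
`Literature.Topology.FourManifolds.exists_marking_centralSurface_of_gkTrisection`: the central
surface of a `(g, k)`-trisection is marked by the surface group `S_g`).  The model surface
`Z = {q_g + z² = c_g}` (`FlowerHandlebody.lean`) is cut into `g` sectors; the sector
`sectorZ g = Z ∩ π⁻¹(wedge)` over `|θ| ≤ π/g` is a one-holed torus bounded by the two valley arcs
`δ₊ = vArc` (over `θ = π/g`) and `δ₋ = vArcR` (over `θ = -π/g`) from pole `0⁺` to pole `0⁻`.  The
input the melon assembly (`SurfaceGroupMelon.exists_surfaceGroup_mulEquiv_of_melon`) needs from each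
sector is a free basis `θ : F⟨a, b⟩ ≅ π₁(sector, 0⁺)` reading the boundary loop as the commutator:

* `exists_basis_sectorZ_bdry` — **there is `θ : FreeGroup (surfaceGen 1) ≃* π₁(sectorZ g, 0⁺)` with
  `θ(r₁) = bdryClass (sectorZ g) _ vArc vArcR = [δ₋ · δ₊⁻¹]`** (Hatcher, §1.2 p. 51).

Proof (all of it explicit and proved here).  §1–§2: the four edges of the reduced spine — upper /
lower lens branch `Lup`, `Ldn` (`I → P`) and upper / lower `C₁` branch `Cup`, `Cdn` (`P → Q`) —
their parameter intervals `JL = [ρ₁, 7^{1/20g}]`, `JC = [7^{1/20g}, ρ₃]`, and the four **atoms**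
`x, y, u, d` (classes of the affine edge paths) with the reading lemmas `cl_eq_atom*`: a path inside
the sector parametrised through an edge (`EdgePath.IsParamOn`) has the class of the atom
(`EdgePaths.lean`, reparametrisation inside the subspace).  §3, §5–§6: the valley arc in four
pieces and the values of the explicit retraction `endMap` (`FlowerSectorEndMap.lean`) on them: the
end map reads `δ₊` as `x u d⁻¹ x⁻¹` and `δ₋` as `y u d⁻¹ y⁻¹`, and the access path `γ` (valley arc up
to radius `7^{1/20g}`, then the meridian over `r = 7^{1/20g}` to `P`) as `x`.  §4: `emap`, the end
map on paths, built on a kernel-opaque copy `endMapI` of `endMap` (see the note there), and the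
**retraction formula** `fromPath_cl_eq_emap`: `[Λ] = [endMap ∘ Λ]` for loops at `P`
(`RetractionInclusionFormula.lean`, the inclusion of the reduced spine being a `π₁`-isomorphism).
§7–§9: splitting lemmas and the reading of the boundary loop `γ⁻¹ · (δ₋ · δ₊⁻¹) · γ` through the
end map: `x⁻¹ · (y u d⁻¹ y⁻¹) · (x u d⁻¹ x⁻¹)⁻¹ · x` (`cl_emap_bigLoop`).  §10: the free basis of
`π₁(sector, P)` on the arc loops `loopR` (`FlowerSectorSpine.lean` /
`BallWithArcsBasis.exists_mulEquiv_apply_of_eq_arcLoop`, core run from `+1` to `-1` in two halves),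
and their readings `ℓ_a = d u⁻¹`, `ℓ_b = y⁻¹ x`.  §11: `ℓ_b⁻¹ ℓ_a⁻¹ ℓ_b ℓ_a` and the end-map reading of
the boundary loop are the same word (`word_agree`); moving the base point to the pole along `γ`
gives the theorem (Mathlib multiplies in `π₁` by `p * q = q.trans p`, whence the reversed arc loops).

Everything is proved; no named facts; one kernel-opaque definition (`endMapI`, by `irreducible_def`,
with `endMapI_def`).

## References

* A. Hatcher, *Algebraic Topology*, CUP (2002), §1.2 p. 51 (`π₁` of surfaces, the boundary word of a
  handle), Example 1.22, Prop. 1.17. [HatcherAT2002]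
* D. Gay, R. Kirby, *Trisecting 4-manifolds*, Geom. Topol. 20 (2016), Def. 1, Remark 2. [GayKirby2016]
-/

open scoped Manifold ContDiff Topology InnerProductSpace Real unitInterval
open Set Function Filter Metric Module Complex

noncomputable section

namespace Literature.Topology.FourManifolds

/-- Local notation: `𝔼 n` is the model Euclidean space `EuclideanSpace ℝ (Fin n)`. -/
local notation "𝔼 " n:arg => EuclideanSpace ℝ (Fin n)

open PlanarThickening PlanarDouble Literature.AlgebraicTopology.Homotopy
  Literature.AlgebraicTopology.FundamentalGroup Literature.AlgebraicTopology.FundamentalGroup.EdgePath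

namespace FlowerModel

variable {g : ℕ}

/-! ### §0 Groupoid bookkeeping -/

section Groupoid

variable {X : Type*} [TopologicalSpace X] {a b c : X}

/-- `(A⁻¹)⁻¹ = A` in the homotopy quotient. [folklore] -/
@[simp] theorem quot_symm_symm (A : Path.Homotopic.Quotient a b) : A.symm.symm = A := by
  induction A using Path.Homotopic.Quotient.ind with
  | mk p => rw [← Path.Homotopic.Quotient.mk_symm, ← Path.Homotopic.Quotient.mk_symm, Path.symm_symm]

/-- `(A · B)⁻¹ = B⁻¹ · A⁻¹` in the homotopy quotient. [folklore] -/
theorem quot_symm_trans (A : Path.Homotopic.Quotient a b) (B : Path.Homotopic.Quotient b c) :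
    (A.trans B).symm = B.symm.trans A.symm := by
  induction A using Path.Homotopic.Quotient.ind with
  | mk p =>
    induction B using Path.Homotopic.Quotient.ind with
    | mk q =>
      rw [← Path.Homotopic.Quotient.mk_trans, ← Path.Homotopic.Quotient.mk_symm, Path.trans_symm,
        Path.Homotopic.Quotient.mk_trans, Path.Homotopic.Quotient.mk_symm, Path.Homotopic.Quotient.mk_symm]

end Groupoid

/-! ### §1 The four edges of the reduced spine -/

/-- **The upper lens edge** `r ↦ (pol r θ_lo(r), 0)` (extended evenly to `r < 0`). [folklore] -/
def Lup (g : ℕ) (r : ℝ) : 𝔼 3 := lift (pol r (thlo g |r|))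

/-- **The lower lens edge** `r ↦ (pol r (-θ_lo(r)), 0)`. [folklore] -/
def Ldn (g : ℕ) (r : ℝ) : 𝔼 3 := lift (pol r (-thlo g |r|))

/-- **The upper `C₁` edge** `r ↦ (r, 0, +√(c - f r))`. [folklore] -/
def Cup (g : ℕ) (r : ℝ) : 𝔼 3 := upperPt (flower g) (level g) (ax r)

/-- **The lower `C₁` edge** `r ↦ (r, 0, -√(c - f r))`. [folklore] -/
def Cdn (g : ℕ) (r : ℝ) : 𝔼 3 := lowerPt (flower g) (level g) (ax r)

/-- The axis map is continuous. [folklore] -/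
theorem continuous_ax : Continuous (ax : ℝ → 𝔼 2) := by
  unfold ax; exact toC.symm.continuous.comp Complex.continuous_ofReal

/-- `r ↦ θ_lo |r|` is continuous. [folklore] -/
theorem continuous_thlo_abs (hg : 2 ≤ g) : Continuous fun r : ℝ => thlo g |r| :=
  (continuousOn_thlo hg).comp_continuous continuous_abs fun r => abs_nonneg r

/-- The upper lens edge is continuous. [folklore] -/
theorem continuous_Lup (hg : 2 ≤ g) : Continuous (Lup g) := by
  show Continuous (⇑lift ∘ (fun p : ℝ × ℝ => pol p.1 p.2) ∘ fun r : ℝ => (r, thlo g |r|))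
  exact lift.continuous.comp (continuous_pol.comp (continuous_id.prodMk (continuous_thlo_abs hg)))

/-- The lower lens edge is continuous. [folklore] -/
theorem continuous_Ldn (hg : 2 ≤ g) : Continuous (Ldn g) := by
  show Continuous (⇑lift ∘ (fun p : ℝ × ℝ => pol p.1 p.2) ∘ fun r : ℝ => (r, -thlo g |r|))
  exact lift.continuous.comp (continuous_pol.comp (continuous_id.prodMk (continuous_thlo_abs hg).neg))

/-- The upper `C₁` edge is continuous. [folklore] -/
theorem continuous_Cup (g : ℕ) : Continuous (Cup g) :=
  (continuous_upperPt contDiff_flower.continuous).comp continuous_ax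

/-- The lower `C₁` edge is continuous. [folklore] -/
theorem continuous_Cdn (g : ℕ) : Continuous (Cdn g) :=
  (continuous_lowerPt contDiff_flower.continuous).comp continuous_ax

/-- The upper lens edge as a bundled continuous map. [folklore] -/
def LupC (hg : 2 ≤ g) : C(ℝ, 𝔼 3) := ⟨Lup g, continuous_Lup hg⟩

/-- The lower lens edge as a bundled continuous map. [folklore] -/
def LdnC (hg : 2 ≤ g) : C(ℝ, 𝔼 3) := ⟨Ldn g, continuous_Ldn hg⟩

/-- The upper `C₁` edge as a bundled continuous map. [folklore] -/
def CupC (g : ℕ) : C(ℝ, 𝔼 3) := ⟨Cup g, continuous_Cup g⟩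

/-- The lower `C₁` edge as a bundled continuous map. [folklore] -/
def CdnC (g : ℕ) : C(ℝ, 𝔼 3) := ⟨Cdn g, continuous_Cdn g⟩

/-- Bookkeeping for the boundary-word computation (`LupC_apply`). [folklore] -/
@[simp] theorem LupC_apply (hg : 2 ≤ g) (r : ℝ) : LupC hg r = Lup g r := rfl
/-- Bookkeeping for the boundary-word computation (`LdnC_apply`). [folklore] -/
@[simp] theorem LdnC_apply (hg : 2 ≤ g) (r : ℝ) : LdnC hg r = Ldn g r := rfl
/-- Bookkeeping for the boundary-word computation (`CupC_apply`). [folklore] -/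
@[simp] theorem CupC_apply (g : ℕ) (r : ℝ) : CupC g r = Cup g r := rfl
/-- Bookkeeping for the boundary-word computation (`CdnC_apply`). [folklore] -/
@[simp] theorem CdnC_apply (g : ℕ) (r : ℝ) : CdnC g r = Cdn g r := rfl

/-- The upper lens edge for `r ≥ 0`. [folklore] -/
theorem Lup_of_nonneg {r : ℝ} (hr : 0 ≤ r) : Lup g r = lift (pol r (thlo g r)) := by
  rw [Lup, abs_of_nonneg hr]

/-- The lower lens edge for `r ≥ 0`. [folklore] -/
theorem Ldn_of_nonneg {r : ℝ} (hr : 0 ≤ r) : Ldn g r = lift (pol r (-thlo g r)) := by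
  rw [Ldn, abs_of_nonneg hr]

/-- `f(7^{1/20g}) = c` (by definition of `c`). [folklore] -/
theorem prof_rt_seven (g : ℕ) : prof g (rt g 7) = level g := rfl

/-- The upper lens edge starts at `I`. [folklore] -/
theorem Lup_rho1 (hg : 2 ≤ g) : Lup g (rho1 hg) = ptI hg := by
  rw [Lup_of_nonneg (rho1_pos hg).le, pol_thlo_eq_ax hg (rho1_pos hg).le le_rfl, ptI]

/-- The upper lens edge ends at `P`. [folklore] -/
theorem Lup_rt_seven (hg : 2 ≤ g) : Lup g (rt g 7) = ptP g := by
  rw [Lup_of_nonneg (rt_pos (by norm_num)).le, thlo_eq_zero_of_mem hg le_rfl (rt_seven_lt_rho3 hg).le,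
    pol_zero_right, ptP]

/-- The lower lens edge starts at `I`. [folklore] -/
theorem Ldn_rho1 (hg : 2 ≤ g) : Ldn g (rho1 hg) = ptI hg := by
  rw [Ldn_of_nonneg (rho1_pos hg).le, thlo_eq_zero_of_le_rho1 hg (rho1_pos hg).le le_rfl, neg_zero,
    pol_zero_right, ptI]

/-- The lower lens edge ends at `P`. [folklore] -/
theorem Ldn_rt_seven (hg : 2 ≤ g) : Ldn g (rt g 7) = ptP g := by
  rw [Ldn_of_nonneg (rt_pos (by norm_num)).le, thlo_eq_zero_of_mem hg le_rfl (rt_seven_lt_rho3 hg).le,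
    neg_zero, pol_zero_right, ptP]

/-- The upper `C₁` edge starts at `P`. [folklore] -/
theorem Cup_rt_seven (g : ℕ) : Cup g (rt g 7) = ptP g := by
  rw [Cup, upperPt_eq_lift (by rw [flower_ax']; rfl), ptP]

/-- The lower `C₁` edge starts at `P`. [folklore] -/
theorem Cdn_rt_seven (g : ℕ) : Cdn g (rt g 7) = ptP g := by
  rw [Cdn, ← upperPt_eq_lowerPt (by rw [flower_ax']; rfl), upperPt_eq_lift (by rw [flower_ax']; rfl), ptP]

/-- The upper `C₁` edge ends at `Q`. [folklore] -/
theorem Cup_rho3 (hg : 2 ≤ g) : Cup g (rho3 hg) = ptQ hg := by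
  rw [Cup, upperPt_eq_lift (by rw [flower_ax', prof_rho3 hg]), ptQ]

/-- The lower `C₁` edge ends at `Q`. [folklore] -/
theorem Cdn_rho3 (hg : 2 ≤ g) : Cdn g (rho3 hg) = ptQ hg := by
  rw [Cdn, ← upperPt_eq_lowerPt (by rw [flower_ax', prof_rho3 hg]), upperPt_eq_lift (by rw [flower_ax', prof_rho3 hg]), ptQ]

/-- The mirror swaps the lens edges. [folklore] -/
theorem refl3_Lup (r : ℝ) : refl3 (Lup g r) = Ldn g r := by
  rw [Lup, refl3_lift, refl_pol, Ldn]

/-- The mirror swaps the lens edges. [folklore] -/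
theorem refl3_Ldn (r : ℝ) : refl3 (Ldn g r) = Lup g r := by
  rw [Ldn, refl3_lift, refl_pol, neg_neg, Lup]

/-- The mirror fixes the upper `C₁` edge. [folklore] -/
theorem refl3_Cup (r : ℝ) : refl3 (Cup g r) = Cup g r := by
  rw [Cup, upperPt, refl3_apply, map_add, map_smul, proj_lift, proj_ez, smul_zero, add_zero, refl_ax]
  simp

/-- The mirror fixes the lower `C₁` edge. [folklore] -/
theorem refl3_Cdn (r : ℝ) : refl3 (Cdn g r) = Cdn g r := by
  rw [Cdn, lowerPt, refl3_apply, map_add, map_smul, proj_lift, proj_ez, smul_zero, add_zero, refl_ax]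
  simp

/-- The lens parameter interval `[ρ₁, 7^{1/20g}]`. [folklore] -/
def JL (hg : 2 ≤ g) : Set ℝ := Icc (rho1 hg) (rt g 7)

/-- The `C₁` parameter interval `[7^{1/20g}, ρ₃]`. [folklore] -/
def JC (hg : 2 ≤ g) : Set ℝ := Icc (rt g 7) (rho3 hg)

/-- Bookkeeping for the boundary-word computation (`convex_JL`). [folklore] -/
theorem convex_JL (hg : 2 ≤ g) : Convex ℝ (JL hg) := convex_Icc _ _
/-- Bookkeeping for the boundary-word computation (`convex_JC`). [folklore] -/
theorem convex_JC (hg : 2 ≤ g) : Convex ℝ (JC hg) := convex_Icc _ _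

/-- The upper lens edge lies on the reduced spine over `[ρ₁, 7^{1/20g}]`. [folklore] -/
theorem Lup_mem_spineZ' (hg : 2 ≤ g) {r : ℝ} (hr : r ∈ JL hg) : Lup g r ∈ spineZ' g hg := by
  have h0 : 0 < r := lt_of_lt_of_le (rho1_pos hg) hr.1
  refine (mem_spineZ'_iff hg).2 ⟨?_, r, ⟨hr.1, hr.2.trans (rt_seven_lt_rho3 hg).le⟩, Or.inl ?_⟩
  · rw [Lup_of_nonneg h0.le, thicken_lift, flower_pol_thlo_lens hg hr.1 hr.2]
  · rw [Lup_of_nonneg h0.le, proj_lift]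

/-- The lower lens edge lies on the reduced spine over `[ρ₁, 7^{1/20g}]`. [folklore] -/
theorem Ldn_mem_spineZ' (hg : 2 ≤ g) {r : ℝ} (hr : r ∈ JL hg) : Ldn g r ∈ spineZ' g hg := by
  have h0 : 0 < r := lt_of_lt_of_le (rho1_pos hg) hr.1
  refine (mem_spineZ'_iff hg).2 ⟨?_, r, ⟨hr.1, hr.2.trans (rt_seven_lt_rho3 hg).le⟩, Or.inr ?_⟩
  · rw [Ldn_of_nonneg h0.le, thicken_lift, flower_pol_neg, flower_pol_thlo_lens hg hr.1 hr.2]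
  · rw [Ldn_of_nonneg h0.le, proj_lift]

/-- `f ≤ c` on `[7^{1/20g}, ρ₃]`. [folklore] -/
theorem flower_ax_le_of_mem_JC (hg : 2 ≤ g) {r : ℝ} (hr : r ∈ JC hg) : flower g (ax r) ≤ level g := by
  rw [flower_ax']
  exact (prof_le_level_iff hg ((rt_pos (by norm_num)).le.trans hr.1)).2 (Or.inr ⟨hr.1, hr.2⟩)

/-- The upper `C₁` edge lies on the reduced spine over `[7^{1/20g}, ρ₃]`. [folklore] -/
theorem Cup_mem_spineZ' (hg : 2 ≤ g) {r : ℝ} (hr : r ∈ JC hg) : Cup g r ∈ spineZ' g hg := by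
  have h0 : 0 < r := lt_of_lt_of_le (rt_pos (by norm_num)) hr.1
  refine (mem_spineZ'_iff hg).2 ⟨upperPt_mem (flower_ax_le_of_mem_JC hg hr), r,
    ⟨(rho1_lt_rt_seven hg).le.trans hr.1, hr.2⟩, Or.inl ?_⟩
  rw [Cup, proj_upperPt, thlo_eq_zero_of_mem hg hr.1 hr.2, pol_zero_right]

/-- The lower `C₁` edge lies on the reduced spine over `[7^{1/20g}, ρ₃]`. [folklore] -/
theorem Cdn_mem_spineZ' (hg : 2 ≤ g) {r : ℝ} (hr : r ∈ JC hg) : Cdn g r ∈ spineZ' g hg := by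
  have h0 : 0 < r := lt_of_lt_of_le (rt_pos (by norm_num)) hr.1
  refine (mem_spineZ'_iff hg).2 ⟨lowerPt_mem (flower_ax_le_of_mem_JC hg hr), r,
    ⟨(rho1_lt_rt_seven hg).le.trans hr.1, hr.2⟩, Or.inl ?_⟩
  rw [Cdn, proj_lowerPt, thlo_eq_zero_of_mem hg hr.1 hr.2, pol_zero_right]

/-- Bookkeeping for the boundary-word computation (`mapsTo_Lup`). [folklore] -/
theorem mapsTo_Lup (hg : 2 ≤ g) : MapsTo (Lup g) (JL hg) (sectorZ g) := fun _ hr =>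
  spineZ'_subset_sectorZ hg (Lup_mem_spineZ' hg hr)
/-- Bookkeeping for the boundary-word computation (`mapsTo_Ldn`). [folklore] -/
theorem mapsTo_Ldn (hg : 2 ≤ g) : MapsTo (Ldn g) (JL hg) (sectorZ g) := fun _ hr =>
  spineZ'_subset_sectorZ hg (Ldn_mem_spineZ' hg hr)
/-- Bookkeeping for the boundary-word computation (`mapsTo_Cup`). [folklore] -/
theorem mapsTo_Cup (hg : 2 ≤ g) : MapsTo (Cup g) (JC hg) (sectorZ g) := fun _ hr =>
  spineZ'_subset_sectorZ hg (Cup_mem_spineZ' hg hr)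
/-- Bookkeeping for the boundary-word computation (`mapsTo_Cdn`). [folklore] -/
theorem mapsTo_Cdn (hg : 2 ≤ g) : MapsTo (Cdn g) (JC hg) (sectorZ g) := fun _ hr =>
  spineZ'_subset_sectorZ hg (Cdn_mem_spineZ' hg hr)

/-- Bookkeeping for the boundary-word computation (`rho1_mem_JL`). [folklore] -/
theorem rho1_mem_JL (hg : 2 ≤ g) : rho1 hg ∈ JL hg := ⟨le_rfl, (rho1_lt_rt_seven hg).le⟩
/-- Bookkeeping for the boundary-word computation (`rt_seven_mem_JL`). [folklore] -/
theorem rt_seven_mem_JL (hg : 2 ≤ g) : rt g 7 ∈ JL hg := ⟨(rho1_lt_rt_seven hg).le, le_rfl⟩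
/-- Bookkeeping for the boundary-word computation (`rt_seven_mem_JC`). [folklore] -/
theorem rt_seven_mem_JC (hg : 2 ≤ g) : rt g 7 ∈ JC hg := ⟨le_rfl, (rt_seven_lt_rho3 hg).le⟩
/-- Bookkeeping for the boundary-word computation (`rho3_mem_JC`). [folklore] -/
theorem rho3_mem_JC (hg : 2 ≤ g) : rho3 hg ∈ JC hg := ⟨(rt_seven_lt_rho3 hg).le, le_rfl⟩

/-! ### §2 Classes of paths inside the sector; the four atoms -/

/-- The class in the homotopy quotient of the sector of a path of `ℝ³` inside the sector. [folklore] -/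
abbrev cl {a b : 𝔼 3} (p : Path a b) (hp : ∀ t, p t ∈ sectorZ g) :
    Path.Homotopic.Quotient (⟨a, p.source ▸ hp 0⟩ : ↥(sectorZ g)) ⟨b, p.target ▸ hp 1⟩ :=
  Path.Homotopic.Quotient.mk (VanKampen.liftPath (sectorZ g) p hp)

/-- Points of an affine edge path over a convex parameter set mapped into the sector lie in the
sector. [folklore] -/
theorem epath_mem {E : C(ℝ, 𝔼 3)} {J : Set ℝ} (hJ : Convex ℝ J) (hE : MapsTo E J (sectorZ g)) {u v : ℝ}
    (hu : u ∈ J) (hv : v ∈ J) (t : I) : epath E u v t ∈ sectorZ g :=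
  hE (affine_mem hJ hu hv t)

/-- **Normal form of an edge piece**: a path inside the sector which is parametrised through an
edge `E` over a convex `J` with `E(J) ⊆ sector`, from `u` to `v`, has the class of the affine
`E`-path from `u` to `v`, cast to its end points. [folklore] -/
theorem cl_eq_cast_of_isParamOn (E : C(ℝ, 𝔼 3)) {J : Set ℝ} (hJ : Convex ℝ J) (hE : MapsTo E J (sectorZ g))
    {a b : 𝔼 3} {p : Path a b} (hp : ∀ t, p t ∈ sectorZ g) {u v : ℝ} (hpar : IsParamOn E J p u v)
    {a' b' : 𝔼 3} (q : Path a' b') (hq : ∀ t, q t ∈ sectorZ g) (hqpar : IsParamOn E J q u v)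
    (ha : a = a') (hb : b = b') :
    cl p hp = (cl q hq).cast (Subtype.ext ha) (Subtype.ext hb) := by
  subst ha hb
  rw [Path.Homotopic.Quotient.cast_rfl_rfl]
  exact hpar.mk_liftPath_eq hJ E.continuous.continuousOn hE hqpar hp hq

/-- The canonical path of the upper lens edge from `I` to `P`. [folklore] -/
def xPath (hg : 2 ≤ g) : Path (ptI hg) (ptP g) :=
  (epath (LupC hg) (rho1 hg) (rt g 7)).cast (Lup_rho1 hg).symm (Lup_rt_seven hg).symm

/-- The canonical path of the lower lens edge from `I` to `P`. [folklore] -/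
def yPath (hg : 2 ≤ g) : Path (ptI hg) (ptP g) :=
  (epath (LdnC hg) (rho1 hg) (rt g 7)).cast (Ldn_rho1 hg).symm (Ldn_rt_seven hg).symm

/-- The canonical path of the upper `C₁` edge from `P` to `Q`. [folklore] -/
def uPath (hg : 2 ≤ g) : Path (ptP g) (ptQ hg) :=
  (epath (CupC g) (rt g 7) (rho3 hg)).cast (Cup_rt_seven g).symm (Cup_rho3 hg).symm

/-- The canonical path of the lower `C₁` edge from `P` to `Q`. [folklore] -/
def dPath (hg : 2 ≤ g) : Path (ptP g) (ptQ hg) :=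
  (epath (CdnC g) (rt g 7) (rho3 hg)).cast (Cdn_rt_seven g).symm (Cdn_rho3 hg).symm

/-- Bookkeeping for the boundary-word computation (`xPath_mem`). [folklore] -/
theorem xPath_mem (hg : 2 ≤ g) (t : I) : xPath hg t ∈ sectorZ g := by
  rw [xPath, Path.cast_coe, epath_apply, LupC_apply]
  exact mapsTo_Lup hg (affine_mem (convex_JL hg) (rho1_mem_JL hg) (rt_seven_mem_JL hg) t)
/-- Bookkeeping for the boundary-word computation (`yPath_mem`). [folklore] -/
theorem yPath_mem (hg : 2 ≤ g) (t : I) : yPath hg t ∈ sectorZ g := by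
  rw [yPath, Path.cast_coe, epath_apply, LdnC_apply]
  exact mapsTo_Ldn hg (affine_mem (convex_JL hg) (rho1_mem_JL hg) (rt_seven_mem_JL hg) t)
/-- Bookkeeping for the boundary-word computation (`uPath_mem`). [folklore] -/
theorem uPath_mem (hg : 2 ≤ g) (t : I) : uPath hg t ∈ sectorZ g := by
  rw [uPath, Path.cast_coe, epath_apply, CupC_apply]
  exact mapsTo_Cup hg (affine_mem (convex_JC hg) (rt_seven_mem_JC hg) (rho3_mem_JC hg) t)
/-- Bookkeeping for the boundary-word computation (`dPath_mem`). [folklore] -/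
theorem dPath_mem (hg : 2 ≤ g) (t : I) : dPath hg t ∈ sectorZ g := by
  rw [dPath, Path.cast_coe, epath_apply, CdnC_apply]
  exact mapsTo_Cdn hg (affine_mem (convex_JC hg) (rt_seven_mem_JC hg) (rho3_mem_JC hg) t)

/-- Bookkeeping for the boundary-word computation (`isParamOn_xPath`). [folklore] -/
theorem isParamOn_xPath (hg : 2 ≤ g) : IsParamOn (LupC hg) (JL hg) (xPath hg) (rho1 hg) (rt g 7) :=
  (isParamOn_epath _ (convex_JL hg) (rho1_mem_JL hg) (rt_seven_mem_JL hg)).cast _ _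
/-- Bookkeeping for the boundary-word computation (`isParamOn_yPath`). [folklore] -/
theorem isParamOn_yPath (hg : 2 ≤ g) : IsParamOn (LdnC hg) (JL hg) (yPath hg) (rho1 hg) (rt g 7) :=
  (isParamOn_epath _ (convex_JL hg) (rho1_mem_JL hg) (rt_seven_mem_JL hg)).cast _ _
/-- Bookkeeping for the boundary-word computation (`isParamOn_uPath`). [folklore] -/
theorem isParamOn_uPath (hg : 2 ≤ g) : IsParamOn (CupC g) (JC hg) (uPath hg) (rt g 7) (rho3 hg) :=
  (isParamOn_epath _ (convex_JC hg) (rt_seven_mem_JC hg) (rho3_mem_JC hg)).cast _ _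
/-- Bookkeeping for the boundary-word computation (`isParamOn_dPath`). [folklore] -/
theorem isParamOn_dPath (hg : 2 ≤ g) : IsParamOn (CdnC g) (JC hg) (dPath hg) (rt g 7) (rho3 hg) :=
  (isParamOn_epath _ (convex_JC hg) (rt_seven_mem_JC hg) (rho3_mem_JC hg)).cast _ _

/-- Bookkeeping for the boundary-word computation (`ptI_mem_sectorZ`). [folklore] -/
theorem ptI_mem_sectorZ (hg : 2 ≤ g) : ptI hg ∈ sectorZ g := (xPath hg).source ▸ xPath_mem hg 0
/-- Bookkeeping for the boundary-word computation (`ptP_mem_sectorZ`). [folklore] -/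
theorem ptP_mem_sectorZ (hg : 2 ≤ g) : ptP g ∈ sectorZ g := (xPath hg).target ▸ xPath_mem hg 1
/-- Bookkeeping for the boundary-word computation (`ptQ_mem_sectorZ`). [folklore] -/
theorem ptQ_mem_sectorZ (hg : 2 ≤ g) : ptQ hg ∈ sectorZ g := (uPath hg).target ▸ uPath_mem hg 1

/-- Reversal of classes of paths inside the sector. [folklore] -/
theorem cl_symm {a b : 𝔼 3} (p : Path a b) (hp : ∀ t, p t ∈ sectorZ g) :
    (cl p hp).symm = cl p.symm (VanKampen.symm_mem hp) := by
  show (Path.Homotopic.Quotient.mk (VanKampen.liftPath (sectorZ g) p hp)).symm = _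
  rw [← Path.Homotopic.Quotient.mk_symm, ← VanKampen.liftPath_symm _ p hp]

/-- Concatenation of classes of paths inside the sector. [folklore] -/
theorem cl_trans {a b c : 𝔼 3} (p : Path a b) (q : Path b c) (hp : ∀ t, p t ∈ sectorZ g)
    (hq : ∀ t, q t ∈ sectorZ g) :
    (cl p hp).trans (cl q hq) = cl (p.trans q) (VanKampen.trans_mem hp hq) := by
  show (Path.Homotopic.Quotient.mk _).trans (Path.Homotopic.Quotient.mk _) = _
  rw [← Path.Homotopic.Quotient.mk_trans, ← VanKampen.liftPath_trans _ p q hp hq]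

/-- Casts of classes of paths inside the sector. [folklore] -/
theorem cl_cast {a b a' b' : 𝔼 3} (p : Path a b) (ha : a' = a) (hb : b' = b) (hp : ∀ t, p t ∈ sectorZ g) :
    cl (p.cast ha hb) (fun t => by rw [Path.cast_coe]; exact hp t) =
      (cl p hp).cast (Subtype.ext ha) (Subtype.ext hb) := by
  subst ha hb; rfl

/-- **The four atoms** `x, y : I ⟶ P` (upper / lower lens edge), `u, d : P ⟶ Q` (upper / lower
`C₁` edge) in the homotopy quotient of the sector. [folklore] -/
def atomX (hg : 2 ≤ g) : Path.Homotopic.Quotient (⟨ptI hg, ptI_mem_sectorZ hg⟩ : ↥(sectorZ g)) ⟨ptP g, ptP_mem_sectorZ hg⟩ :=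
  cl (xPath hg) (xPath_mem hg)
/-- Auxiliary definition for the boundary-word computation (`atomY`). [folklore] -/
def atomY (hg : 2 ≤ g) : Path.Homotopic.Quotient (⟨ptI hg, ptI_mem_sectorZ hg⟩ : ↥(sectorZ g)) ⟨ptP g, ptP_mem_sectorZ hg⟩ :=
  cl (yPath hg) (yPath_mem hg)
/-- Auxiliary definition for the boundary-word computation (`atomU`). [folklore] -/
def atomU (hg : 2 ≤ g) : Path.Homotopic.Quotient (⟨ptP g, ptP_mem_sectorZ hg⟩ : ↥(sectorZ g)) ⟨ptQ hg, ptQ_mem_sectorZ hg⟩ :=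
  cl (uPath hg) (uPath_mem hg)
/-- Auxiliary definition for the boundary-word computation (`atomD`). [folklore] -/
def atomD (hg : 2 ≤ g) : Path.Homotopic.Quotient (⟨ptP g, ptP_mem_sectorZ hg⟩ : ↥(sectorZ g)) ⟨ptQ hg, ptQ_mem_sectorZ hg⟩ :=
  cl (dPath hg) (dPath_mem hg)

/-- **Reading an upper-lens piece**: a path inside the sector parametrised through `Lup` over
`[ρ₁, 7^{1/20g}]` from `ρ₁` to `7^{1/20g}` has class `x` (cast). [folklore] -/
theorem cl_eq_atomX {a b : 𝔼 3} {p : Path a b} (hg : 2 ≤ g) (hp : ∀ t, p t ∈ sectorZ g)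
    (hpar : IsParamOn (LupC hg) (JL hg) p (rho1 hg) (rt g 7)) (ha : a = ptI hg) (hb : b = ptP g) :
    cl p hp = (atomX hg).cast (Subtype.ext ha) (Subtype.ext hb) :=
  cl_eq_cast_of_isParamOn (LupC hg) (convex_JL hg) (mapsTo_Lup hg) hp hpar _ _ (isParamOn_xPath hg) ha hb

/-- Reading a reversed upper-lens piece. [folklore] -/
theorem cl_eq_atomX_symm {a b : 𝔼 3} {p : Path a b} (hg : 2 ≤ g) (hp : ∀ t, p t ∈ sectorZ g)
    (hpar : IsParamOn (LupC hg) (JL hg) p (rt g 7) (rho1 hg)) (ha : a = ptP g) (hb : b = ptI hg) :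
    cl p hp = (atomX hg).symm.cast (Subtype.ext ha) (Subtype.ext hb) := by
  rw [atomX, cl_symm]
  exact cl_eq_cast_of_isParamOn (LupC hg) (convex_JL hg) (mapsTo_Lup hg) hp hpar _ _ (isParamOn_xPath hg).symm ha hb

/-- Reading a lower-lens piece. [folklore] -/
theorem cl_eq_atomY {a b : 𝔼 3} {p : Path a b} (hg : 2 ≤ g) (hp : ∀ t, p t ∈ sectorZ g)
    (hpar : IsParamOn (LdnC hg) (JL hg) p (rho1 hg) (rt g 7)) (ha : a = ptI hg) (hb : b = ptP g) :
    cl p hp = (atomY hg).cast (Subtype.ext ha) (Subtype.ext hb) :=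
  cl_eq_cast_of_isParamOn (LdnC hg) (convex_JL hg) (mapsTo_Ldn hg) hp hpar _ _ (isParamOn_yPath hg) ha hb

/-- Reading a reversed lower-lens piece. [folklore] -/
theorem cl_eq_atomY_symm {a b : 𝔼 3} {p : Path a b} (hg : 2 ≤ g) (hp : ∀ t, p t ∈ sectorZ g)
    (hpar : IsParamOn (LdnC hg) (JL hg) p (rt g 7) (rho1 hg)) (ha : a = ptP g) (hb : b = ptI hg) :
    cl p hp = (atomY hg).symm.cast (Subtype.ext ha) (Subtype.ext hb) := by
  rw [atomY, cl_symm]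
  exact cl_eq_cast_of_isParamOn (LdnC hg) (convex_JL hg) (mapsTo_Ldn hg) hp hpar _ _ (isParamOn_yPath hg).symm ha hb

/-- Reading an upper `C₁` piece. [folklore] -/
theorem cl_eq_atomU {a b : 𝔼 3} {p : Path a b} (hg : 2 ≤ g) (hp : ∀ t, p t ∈ sectorZ g)
    (hpar : IsParamOn (CupC g) (JC hg) p (rt g 7) (rho3 hg)) (ha : a = ptP g) (hb : b = ptQ hg) :
    cl p hp = (atomU hg).cast (Subtype.ext ha) (Subtype.ext hb) :=
  cl_eq_cast_of_isParamOn (CupC g) (convex_JC hg) (mapsTo_Cup hg) hp hpar _ _ (isParamOn_uPath hg) ha hb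

/-- Reading a reversed upper `C₁` piece. [folklore] -/
theorem cl_eq_atomU_symm {a b : 𝔼 3} {p : Path a b} (hg : 2 ≤ g) (hp : ∀ t, p t ∈ sectorZ g)
    (hpar : IsParamOn (CupC g) (JC hg) p (rho3 hg) (rt g 7)) (ha : a = ptQ hg) (hb : b = ptP g) :
    cl p hp = (atomU hg).symm.cast (Subtype.ext ha) (Subtype.ext hb) := by
  rw [atomU, cl_symm]
  exact cl_eq_cast_of_isParamOn (CupC g) (convex_JC hg) (mapsTo_Cup hg) hp hpar _ _ (isParamOn_uPath hg).symm ha hb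

/-- Reading a lower `C₁` piece. [folklore] -/
theorem cl_eq_atomD {a b : 𝔼 3} {p : Path a b} (hg : 2 ≤ g) (hp : ∀ t, p t ∈ sectorZ g)
    (hpar : IsParamOn (CdnC g) (JC hg) p (rt g 7) (rho3 hg)) (ha : a = ptP g) (hb : b = ptQ hg) :
    cl p hp = (atomD hg).cast (Subtype.ext ha) (Subtype.ext hb) :=
  cl_eq_cast_of_isParamOn (CdnC g) (convex_JC hg) (mapsTo_Cdn hg) hp hpar _ _ (isParamOn_dPath hg) ha hb

/-- Reading a reversed lower `C₁` piece. [folklore] -/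
theorem cl_eq_atomD_symm {a b : 𝔼 3} {p : Path a b} (hg : 2 ≤ g) (hp : ∀ t, p t ∈ sectorZ g)
    (hpar : IsParamOn (CdnC g) (JC hg) p (rho3 hg) (rt g 7)) (ha : a = ptQ hg) (hb : b = ptP g) :
    cl p hp = (atomD hg).symm.cast (Subtype.ext ha) (Subtype.ext hb) := by
  rw [atomD, cl_symm]
  exact cl_eq_cast_of_isParamOn (CdnC g) (convex_JC hg) (mapsTo_Cdn hg) hp hpar _ _ (isParamOn_dPath hg).symm ha hb

/-! ### §3 The end map along the valley arc -/

/-- Valley ray points up to `ρ₄` lie in the wedge. [folklore] -/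
theorem pol_valley_mem_wedge (hg : 2 ≤ g) {s : ℝ} (hs0 : 0 ≤ s) (hs : s ≤ rho4 hg) : pol s (π / g) ∈ wedge g := by
  have hg1 : 1 ≤ g := by omega
  refine ⟨by rw [flower_pol_valley hg1]; exact (vprof_le_level_iff hg hs0).2 hs, ?_⟩
  rcases hs0.eq_or_lt with h | h
  · rw [← h, pol_zero_left, map_zero, Complex.arg_zero, abs_zero]; positivity
  · rw [arg_toC_pol h (mem_Ioc_of_mem hg1 (by positivity) le_rfl), abs_of_nonneg (by positivity)]

/-- **The valley arc lies in the sector.** [folklore] -/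
theorem vArcFun_mem_sectorZ (hg : 2 ≤ g) {s : ℝ} (hs0 : 0 ≤ s) (hs : s ≤ 2 * rho4 hg) : vArcFun hg s ∈ sectorZ g := by
  refine ⟨thicken_vArcFun hg hs0 hs, ?_⟩
  show proj (vArcFun hg s) ∈ wedge g
  rcases le_or_gt s (rho4 hg) with h | h
  · rw [proj_vArcFun_of_le hg h]; exact pol_valley_mem_wedge hg hs0 h
  · rw [proj_vArcFun_of_lt hg h]; exact pol_valley_mem_wedge hg (by linarith) (by linarith)

/-- The valley arc path lies in the sector. [folklore] -/
theorem vArc_mem_sectorZ (hg : 2 ≤ g) (t : I) : vArc hg t ∈ sectorZ g := by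
  rw [vArc_apply]
  have h4 := rho4_pos hg
  exact vArcFun_mem_sectorZ hg (by nlinarith [t.2.1]) (by nlinarith [t.2.2])

/-- **The end map on the low part of the valley arc** (`0 ≤ s ≤ 7^{1/20g}`): the upper lens edge at
parameter `max ρ₁ s`. [folklore] -/
theorem endMap_vArcFun_low (hg : 2 ≤ g) {s : ℝ} (hs0 : 0 ≤ s) (hs : s ≤ rt g 7) :
    endMap hg (vArcFun hg s) = Lup g (max (rho1 hg) s) := by
  have hs4 : s ≤ rho4 hg := hs.trans (rt_seven_lt_rho4 hg).le
  have hπ : proj (vArcFun hg s) = pol s (π / g) := proj_vArcFun_of_le hg hs4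
  rcases le_total s (rho1 hg) with h | h
  · rw [endMap_valley_inner hg hs0 h hπ, max_eq_left h, Lup_rho1]
  · rw [endMap_valley_lens hg h hs hπ, max_eq_right h, Lup_of_nonneg hs0]

/-- **The end map on the upper middle part of the valley arc** (`7^{1/20g} ≤ s ≤ ρ₄`): the upper
`C₁` edge at parameter `min s ρ₃`. [folklore] -/
theorem endMap_vArcFun_mid (hg : 2 ≤ g) {s : ℝ} (hs7 : rt g 7 ≤ s) (hs : s ≤ rho4 hg) :
    endMap hg (vArcFun hg s) = Cup g (min s (rho3 hg)) := by
  have hs0 : 0 ≤ s := (rt_pos (by norm_num)).le.trans hs7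
  have hπ : proj (vArcFun hg s) = pol s (π / g) := proj_vArcFun_of_le hg hs
  rcases le_total s (rho3 hg) with h | h
  · have hmem : vArcFun hg s ∈ sectorZ g := vArcFun_mem_sectorZ hg hs0 (by linarith [rho4_pos hg])
    rw [endMap_valley_mid hg hmem hs7 h hπ, vArcFun_apply_two_of_le hg hs, if_pos (vHt_nonneg s), min_eq_left h, Cup]
  · rw [endMap_valley_outer hg h hs hπ, min_eq_right h, Cup_rho3]

/-- **The end map on the lower middle part of the valley arc** (`ρ₄ ≤ s ≤ 2ρ₄ - 7^{1/20g}`, radius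
`2ρ₄ - s`, lower sheet): the lower `C₁` edge at parameter `min (2ρ₄ - s) ρ₃`. [folklore] -/
theorem endMap_vArcFun_mid' (hg : 2 ≤ g) {s : ℝ} (hs : rho4 hg ≤ s) (hs7 : s ≤ 2 * rho4 hg - rt g 7) :
    endMap hg (vArcFun hg s) = Cdn g (min (2 * rho4 hg - s) (rho3 hg)) := by
  set ρ := 2 * rho4 hg - s with hρ
  have hρ7 : rt g 7 ≤ ρ := by linarith
  have hρ4 : ρ ≤ rho4 hg := by linarith
  have hρ0 : 0 ≤ ρ := (rt_pos (by norm_num)).le.trans hρ7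
  rcases hs.eq_or_lt with h | h
  · -- `s = ρ₄`: the seam point, collapsed to `Q`
    have hπ : proj (vArcFun hg s) = pol s (π / g) := proj_vArcFun_of_le hg h.ge
    rw [endMap_valley_outer hg (by rw [← h]; exact (rho3_lt_rho4 hg).le) h.ge hπ,
      show min ρ (rho3 hg) = rho3 hg from min_eq_right (by rw [hρ, ← h]; linarith [rho3_lt_rho4 hg]), Cdn_rho3]
  · have hπ : proj (vArcFun hg s) = pol ρ (π / g) := proj_vArcFun_of_lt hg h
    rcases le_or_gt (rho3 hg) ρ with h3 | h3
    · rw [endMap_valley_outer hg h3 hρ4 hπ, min_eq_right h3, Cdn_rho3]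
    · have hmem : vArcFun hg s ∈ sectorZ g := vArcFun_mem_sectorZ hg (by linarith [rho4_pos hg]) (by linarith [rt_pos (g := g) (by norm_num : (0:ℝ) < 7)])
      have hneg : ¬ 0 ≤ vArcFun hg s 2 := by
        rw [vArcFun_apply_two_of_lt hg h, not_le, neg_lt_zero]
        exact vHt_pos hg hρ0 (h3.trans (rho3_lt_rho4 hg))
      rw [endMap_valley_mid hg hmem hρ7 h3.le hπ, if_neg hneg, min_eq_left h3.le, Cdn]

/-- **The end map on the top part of the valley arc** (`2ρ₄ - 7^{1/20g} ≤ s ≤ 2ρ₄`, radius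
`2ρ₄ - s ≤ 7^{1/20g}`): the upper lens edge at parameter `max ρ₁ (2ρ₄ - s)`. [folklore] -/
theorem endMap_vArcFun_top (hg : 2 ≤ g) {s : ℝ} (hs7 : 2 * rho4 hg - rt g 7 ≤ s) (hs : s ≤ 2 * rho4 hg) :
    endMap hg (vArcFun hg s) = Lup g (max (rho1 hg) (2 * rho4 hg - s)) := by
  set ρ := 2 * rho4 hg - s with hρ
  have hρ7 : ρ ≤ rt g 7 := by linarith
  have hρ0 : 0 ≤ ρ := by linarith
  have hlt : rho4 hg < s := by linarith [rt_seven_lt_rho4 hg]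
  have hπ : proj (vArcFun hg s) = pol ρ (π / g) := proj_vArcFun_of_lt hg hlt
  rcases le_total ρ (rho1 hg) with h | h
  · rw [endMap_valley_inner hg hρ0 h hπ, max_eq_left h, Lup_rho1]
  · rw [endMap_valley_lens hg h hρ7 hπ, max_eq_right h, Lup_of_nonneg hρ0]

/-! ### §4 The end map along paths inside the sector -/

/-- **A kernel-opaque copy of the end map** (`endMapI_def : endMapI hg p = endMap hg p`): paths
built from the end map carry their end points in their types, and keeping the heavy three-stage
formula definitionally opaque keeps type-checking of the words below cheap. [folklore] -/
irreducible_def endMapI (hg : 2 ≤ g) (p : 𝔼 3) : 𝔼 3 := endMap hg p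

/-- Bookkeeping for the boundary-word computation (`endMapI_eq`). [folklore] -/
theorem endMapI_eq (hg : 2 ≤ g) : endMapI hg = endMap hg := funext (endMapI_def hg)

/-- **The end map applied to a path inside the sector.** [folklore] -/
def emap (hg : 2 ≤ g) {a b : 𝔼 3} (p : Path a b) (hp : ∀ t, p t ∈ sectorZ g) :
    Path (endMapI hg a) (endMapI hg b) where
  toFun t := endMapI hg (p t)
  continuous_toFun := by
    rw [endMapI_eq]
    exact (continuousOn_endMap hg).comp_continuous p.continuous hp
  source' := by rw [p.source]
  target' := by rw [p.target]

/-- Bookkeeping for the boundary-word computation (`emap_apply`). [folklore] -/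
theorem emap_apply (hg : 2 ≤ g) {a b : 𝔼 3} (p : Path a b) (hp : ∀ t, p t ∈ sectorZ g) (t : I) :
    emap hg p hp t = endMapI hg (p t) := rfl

/-- Values of the opaque end map: in the reduced spine, fixed on it, mirror-equivariant. [folklore] -/
theorem endMapI_mem (hg : 2 ≤ g) {p : 𝔼 3} (hp : p ∈ sectorZ g) : endMapI hg p ∈ spineZ' g hg := by
  rw [endMapI_def]; exact endMap_mem hg hp

/-- Bookkeeping for the boundary-word computation (`endMapI_eq_self`). [folklore] -/
theorem endMapI_eq_self (hg : 2 ≤ g) {p : 𝔼 3} (hp : p ∈ spineZ' g hg) : endMapI hg p = p := by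
  rw [endMapI_def]; exact endMap_eq_self hg hp

/-- Bookkeeping for the boundary-word computation (`endMapI_refl3`). [folklore] -/
theorem endMapI_refl3 (hg : 2 ≤ g) {p : 𝔼 3} (hp : p ∈ sectorZ g) : endMapI hg (refl3 p) = refl3 (endMapI hg p) := by
  rw [endMapI_def, endMapI_def]; exact endMap_refl3 hg hp

/-- The end map path lies in the reduced spine. [folklore] -/
theorem emap_mem_spineZ' (hg : 2 ≤ g) {a b : 𝔼 3} (p : Path a b) (hp : ∀ t, p t ∈ sectorZ g) (t : I) :
    emap hg p hp t ∈ spineZ' g hg := endMapI_mem hg (hp t)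

/-- The end map path lies in the sector. [folklore] -/
theorem emap_mem (hg : 2 ≤ g) {a b : 𝔼 3} (p : Path a b) (hp : ∀ t, p t ∈ sectorZ g) (t : I) :
    emap hg p hp t ∈ sectorZ g := spineZ'_subset_sectorZ hg (endMapI_mem hg (hp t))

/-- The end map commutes with concatenation. [folklore] -/
theorem emap_trans (hg : 2 ≤ g) {a b c : 𝔼 3} (p : Path a b) (q : Path b c) (hp : ∀ t, p t ∈ sectorZ g)
    (hq : ∀ t, q t ∈ sectorZ g) :
    emap hg (p.trans q) (VanKampen.trans_mem hp hq) = (emap hg p hp).trans (emap hg q hq) := by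
  ext t
  rw [emap_apply, Path.trans_apply, Path.trans_apply]
  split_ifs <;> rfl

/-- The end map commutes with reversal. [folklore] -/
theorem emap_symm (hg : 2 ≤ g) {a b : 𝔼 3} (p : Path a b) (hp : ∀ t, p t ∈ sectorZ g) :
    emap hg p.symm (VanKampen.symm_mem hp) = (emap hg p hp).symm := by
  ext t; rfl

/-- The end map commutes with casts. [folklore] -/
theorem emap_cast (hg : 2 ≤ g) {a b a' b' : 𝔼 3} (p : Path a b) (hp : ∀ t, p t ∈ sectorZ g) (ha : a' = a) (hb : b' = b)
    (h : ∀ t, p.cast ha hb t ∈ sectorZ g) :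
    emap hg (p.cast ha hb) h = (emap hg p hp).cast (congrArg (endMapI hg) ha) (congrArg (endMapI hg) hb) := by
  ext t; rfl

/-- The end map commutes with the mirror. [folklore] -/
theorem emap_map_refl3 (hg : 2 ≤ g) {a b : 𝔼 3} (p : Path a b) (hp : ∀ t, p t ∈ sectorZ g)
    (h : ∀ t, p.map refl3.continuous t ∈ sectorZ g) :
    emap hg (p.map refl3.continuous) h =
      ((emap hg p hp).map refl3.continuous).cast (endMapI_refl3 hg (p.source ▸ hp 0)) (endMapI_refl3 hg (p.target ▸ hp 1)) := by
  apply Path.ext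
  funext t
  simp only [emap_apply, Path.map_coe, Function.comp_apply, Path.cast_coe]
  exact endMapI_refl3 hg (hp t)

/-- `P` is fixed by the end map. [folklore] -/
theorem endMap_ptP (hg : 2 ≤ g) : endMapI hg (ptP g) = ptP g := endMapI_eq_self hg (ptP_mem_spineZ' hg)

/-- **The retraction formula for the sector**: the class of a loop at `P` inside the sector is the
class of its image under the end map (a retraction onto the reduced spine, whose inclusion is a
`π₁`-isomorphism). [cite: HatcherAT2002, Prop. 1.17] -/
theorem fromPath_cl_eq_emap (hg : 2 ≤ g) (Λ : Path (ptP g) (ptP g)) (hΛ : ∀ t, Λ t ∈ sectorZ g) :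
    FundamentalGroup.fromPath (cl Λ hΛ) =
      FundamentalGroup.fromPath (cl ((emap hg Λ hΛ).cast (endMap_ptP hg).symm (endMap_ptP hg).symm)
        (fun t => by rw [Path.cast_coe]; exact emap_mem hg Λ hΛ t)) := by
  have hsub := spineZ'_subset_sectorZ hg
  have hxA := ptP_mem_spineZ' hg
  have hbij := VanKampen.bijective_inclHomOfSubset_of_isStrongDeformationRetractOf
    (spineZ'_isStrongDeformationRetractOf_sectorZ hg) hsub hxA
  have key := VanKampen.inclHomOfSubset_fromPath_map_retraction hsub hxA hbij (retr hg) (retr_inclusion hg hsub)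
    (VanKampen.liftPath (sectorZ g) Λ hΛ)
  have e1 : (((VanKampen.liftPath (sectorZ g) Λ hΛ).map (retr hg).continuous).cast
      (retr_inclusion hg hsub ⟨ptP g, hxA⟩).symm (retr_inclusion hg hsub ⟨ptP g, hxA⟩).symm) =
      VanKampen.liftPath (spineZ' g hg) ((emap hg Λ hΛ).cast (endMap_ptP hg).symm (endMap_ptP hg).symm)
        (fun t => by rw [Path.cast_coe]; exact emap_mem_spineZ' hg Λ hΛ t) := by
    apply Path.ext
    funext t
    apply Subtype.ext
    show endMap hg (Λ t) = endMapI hg (Λ t)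
    rw [endMapI_def]
  rw [e1, VanKampen.inclHomOfSubset_fromPath_liftPath] at key
  exact key.symm

/-! ### §5 The access path `γ` from the pole to `P` and the valley arc in four pieces -/

/-- The valley arc function as a bundled continuous map. [folklore] -/
def vC (hg : 2 ≤ g) : C(ℝ, 𝔼 3) := ⟨vArcFun hg, continuous_vArcFun hg⟩

/-- Bookkeeping for the boundary-word computation (`vC_apply`). [folklore] -/
@[simp] theorem vC_apply (hg : 2 ≤ g) (s : ℝ) : vC hg s = vArcFun hg s := rfl

/-- The valley parameter interval `[0, 2ρ₄]`. [folklore] -/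
def JV (hg : 2 ≤ g) : Set ℝ := Icc 0 (2 * rho4 hg)

/-- Bookkeeping for the boundary-word computation (`convex_JV`). [folklore] -/
theorem convex_JV (hg : 2 ≤ g) : Convex ℝ (JV hg) := convex_Icc _ _

/-- Bookkeeping for the boundary-word computation (`mapsTo_vC`). [folklore] -/
theorem mapsTo_vC (hg : 2 ≤ g) : MapsTo (vC hg) (JV hg) (sectorZ g) := fun _ hs => vArcFun_mem_sectorZ hg hs.1 hs.2

/-- Bookkeeping for the boundary-word computation (`zero_mem_JV`). [folklore] -/
theorem zero_mem_JV (hg : 2 ≤ g) : (0 : ℝ) ∈ JV hg := ⟨le_rfl, by linarith [rho4_pos hg]⟩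
/-- Bookkeeping for the boundary-word computation (`rt_seven_mem_JV`). [folklore] -/
theorem rt_seven_mem_JV (hg : 2 ≤ g) : rt g 7 ∈ JV hg :=
  ⟨(rt_pos (by norm_num)).le, by linarith [rt_seven_lt_rho4 hg, rho4_pos hg]⟩
/-- Bookkeeping for the boundary-word computation (`rho4_mem_JV`). [folklore] -/
theorem rho4_mem_JV (hg : 2 ≤ g) : rho4 hg ∈ JV hg := ⟨(rho4_pos hg).le, by linarith [rho4_pos hg]⟩
/-- Bookkeeping for the boundary-word computation (`sub_rt_seven_mem_JV`). [folklore] -/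
theorem sub_rt_seven_mem_JV (hg : 2 ≤ g) : 2 * rho4 hg - rt g 7 ∈ JV hg :=
  ⟨by linarith [rt_seven_lt_rho4 hg, rho4_pos hg], by linarith [rt_pos (g := g) (by norm_num : (0:ℝ) < 7)]⟩
/-- Bookkeeping for the boundary-word computation (`two_mul_mem_JV`). [folklore] -/
theorem two_mul_mem_JV (hg : 2 ≤ g) : 2 * rho4 hg ∈ JV hg := ⟨by linarith [rho4_pos hg], le_rfl⟩

/-- The point `V₇` of the valley arc over radius `7^{1/20g}` (upper sheet). [folklore] -/
def ptV (hg : 2 ≤ g) : 𝔼 3 := vArcFun hg (rt g 7)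

/-- **The first leg of the access path**: along the upper sheet of the valley arc from the pole to `V₇`. [folklore] -/
def wPath (hg : 2 ≤ g) : Path (top g) (ptV hg) :=
  (epath (vC hg) 0 (rt g 7)).cast (vArcFun_zero hg).symm rfl

/-- Bookkeeping for the boundary-word computation (`wPath_apply`). [folklore] -/
theorem wPath_apply (hg : 2 ≤ g) (t : I) : wPath hg t = vArcFun hg (0 + (rt g 7 - 0) * t) := rfl

/-- Bookkeeping for the boundary-word computation (`wPath_mem`). [folklore] -/
theorem wPath_mem (hg : 2 ≤ g) (t : I) : wPath hg t ∈ sectorZ g := by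
  rw [wPath_apply]
  exact mapsTo_vC hg (affine_mem (convex_JV hg) (zero_mem_JV hg) (rt_seven_mem_JV hg) t)

/-- `q(pol 7^{1/20g} θ) ≤ c`. [folklore] -/
theorem flower_pol_rt_seven_le (θ : ℝ) : flower g (pol (rt g 7) θ) ≤ level g :=
  (flower_pol_le_prof (rt_pos (by norm_num)).le θ).trans_eq (prof_rt_seven g)

/-- **The second leg of the access path**: the meridian arc over the circle `r = 7^{1/20g}` (upper
sheet) from `V₇` (angle `π/g`) to `P` (angle `0`). [folklore] -/
def merid (hg : 2 ≤ g) : Path (ptV hg) (ptP g) where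
  toFun t := upperPt (flower g) (level g) (pol (rt g 7) ((1 - (t : ℝ)) * (π / g)))
  continuous_toFun := by
    show Continuous ((upperPt (flower g) (level g)) ∘ (fun p : ℝ × ℝ => pol p.1 p.2) ∘
      fun t : I => (rt g 7, (1 - (t : ℝ)) * (π / g)))
    exact (continuous_upperPt contDiff_flower.continuous).comp (continuous_pol.comp (continuous_const.prodMk (by fun_prop)))
  source' := by
    have hg1 : 1 ≤ g := by omega
    simp only [Set.Icc.coe_zero, sub_zero, one_mul]
    rw [ptV, vArcFun_of_le hg (rt_seven_lt_rho4 hg).le, upperPt, flower_pol_valley hg1, vHt]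
  target' := by
    simp only [Set.Icc.coe_one, sub_self, zero_mul, pol_zero_right]
    exact Cup_rt_seven g

/-- Bookkeeping for the boundary-word computation (`merid_apply`). [folklore] -/
theorem merid_apply (hg : 2 ≤ g) (t : I) :
    merid hg t = upperPt (flower g) (level g) (pol (rt g 7) ((1 - (t : ℝ)) * (π / g))) := rfl

/-- Upper-sheet points over the circle `r = 7^{1/20g}`, `0 ≤ θ ≤ π/g`, lie in the sector. [folklore] -/
theorem upperPt_pol_rt_seven_mem (hg : 2 ≤ g) {θ : ℝ} (h0 : 0 ≤ θ) (h1 : θ ≤ π / g) :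
    upperPt (flower g) (level g) (pol (rt g 7) θ) ∈ sectorZ g := by
  have hg1 : 1 ≤ g := by omega
  refine ⟨upperPt_mem (flower_pol_rt_seven_le θ), ?_⟩
  show proj (upperPt (flower g) (level g) (pol (rt g 7) θ)) ∈ wedge g
  rw [proj_upperPt]
  exact ⟨flower_pol_rt_seven_le θ, by rw [arg_toC_pol (rt_pos (by norm_num)) (mem_Ioc_of_mem hg1 h0 h1), abs_of_nonneg h0]; exact h1⟩

/-- Bookkeeping for the boundary-word computation (`pi_div_pos`). [folklore] -/
theorem pi_div_pos (hg : 2 ≤ g) : 0 < π / g :=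
  div_pos Real.pi_pos (by exact_mod_cast (show 0 < g by omega))

/-- Bookkeeping for the boundary-word computation (`merid_mem`). [folklore] -/
theorem merid_mem (hg : 2 ≤ g) (t : I) : merid hg t ∈ sectorZ g := by
  rw [merid_apply]
  have h := pi_div_pos hg
  exact upperPt_pol_rt_seven_mem hg (by nlinarith [t.2.2]) (by nlinarith [t.2.1])

/-- **The end map collapses the meridian arc to `P`.** [folklore] -/
theorem endMap_upperPt_pol_rt_seven (hg : 2 ≤ g) {θ : ℝ} (h0 : 0 ≤ θ) (h1 : θ ≤ π / g) :
    endMap hg (upperPt (flower g) (level g) (pol (rt g 7) θ)) = ptP g := by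
  have hg1 : 1 ≤ g := by omega
  have hg' : (2 : ℝ) ≤ g := by exact_mod_cast hg
  have hπ : θ ≤ π := h1.trans ((div_le_div_of_nonneg_left Real.pi_pos.le two_pos hg').trans (by linarith [Real.pi_pos]))
  have hfloor : sqzW g 1 (pol (rt g 7) θ) = ax (rt g 7) := by
    have him : 0 ≤ (toC (pol (rt g 7) θ)).im := by
      rw [im_toC_pol]; exact mul_nonneg (rt_pos (by norm_num)).le (Real.sin_nonneg_of_nonneg_of_le_pi h0 hπ)
    rw [sqzW_of_im_nonneg 1 him, sqz_pol 1 (rt_pos (by norm_num)) (mem_Ioc_of_mem hg1 h0 h1),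
      thlo_eq_zero_of_mem hg le_rfl (rt_seven_lt_rho3 hg).le, show (0 : ℝ) + (1 - 1) * (θ - 0) = 0 by ring, pol_zero_right]
  have hs1 : stage1 g (upperPt (flower g) (level g) (pol (rt g 7) θ)) = ptP g := by
    rw [stage1, liftMap_of_seam_image (by rw [proj_upperPt, hfloor, flower_ax']; rfl), proj_upperPt, hfloor, ptP]
  rw [endMap, hs1, stage2_eq_self hg (ptP_mem_spineZ' hg).1, whisker_eq_self hg 1 (ptP_mem_spineZ' hg)]

/-- The end map of the meridian leg is the constant `Lup`-piece at `P`. [folklore] -/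
theorem isParamOn_emap_merid (hg : 2 ≤ g) :
    IsParamOn (LupC hg) (JL hg) (emap hg (merid hg) (merid_mem hg)) (rt g 7) (rt g 7) := by
  have h := pi_div_pos hg
  refine isParamOn_of_forall (fun _ => rt g 7) continuous_const (fun _ => rt_seven_mem_JL hg) (fun t => ?_) rfl rfl
  show endMapI hg (merid hg t) = Lup g (rt g 7)
  rw [endMapI_def, merid_apply, endMap_upperPt_pol_rt_seven hg (by nlinarith [t.2.2]) (by nlinarith [t.2.1]), Lup_rt_seven hg]

/-- The end map of the first leg is an `Lup`-piece from `ρ₁` to `7^{1/20g}` (parameter `max ρ₁ s`). [folklore] -/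
theorem isParamOn_emap_wPath (hg : 2 ≤ g) :
    IsParamOn (LupC hg) (JL hg) (emap hg (wPath hg) (wPath_mem hg)) (rho1 hg) (rt g 7) := by
  have h7 := rt_pos (g := g) (by norm_num : (0:ℝ) < 7)
  have h17 := rho1_lt_rt_seven hg
  refine isParamOn_of_forall (fun t => max (rho1 hg) (0 + (rt g 7 - 0) * t)) (by fun_prop) (fun t => ?_) (fun t => ?_) ?_ ?_
  · exact show max (rho1 hg) (0 + (rt g 7 - 0) * (t : ℝ)) ∈ Icc (rho1 hg) (rt g 7) from
      ⟨le_max_left _ _, max_le h17.le (by nlinarith [t.2.2])⟩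
  · show endMapI hg (wPath hg t) = Lup g (max (rho1 hg) (0 + (rt g 7 - 0) * t))
    rw [endMapI_def, wPath_apply, endMap_vArcFun_low hg (by nlinarith [t.2.1]) (by nlinarith [t.2.2])]
  · simp only [Set.Icc.coe_zero, mul_zero, add_zero]; exact max_eq_left (rho1_pos hg).le
  · simp only [Set.Icc.coe_one, mul_one, zero_add, sub_zero]; exact max_eq_right h17.le

/-- **The access path** `γ = w · m` from the pole `0⁺` to `P`. [folklore] -/
def gam (hg : 2 ≤ g) : Path (top g) (ptP g) := (wPath hg).trans (merid hg)

/-- Bookkeeping for the boundary-word computation (`gam_mem`). [folklore] -/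
theorem gam_mem (hg : 2 ≤ g) (t : I) : gam hg t ∈ sectorZ g := VanKampen.trans_mem (wPath_mem hg) (merid_mem hg) t

/-- The end map of the access path is an `Lup`-piece from `ρ₁` to `7^{1/20g}`. [folklore] -/
theorem isParamOn_emap_gam (hg : 2 ≤ g) :
    IsParamOn (LupC hg) (JL hg) (emap hg (gam hg) (gam_mem hg)) (rho1 hg) (rt g 7) := by
  show IsParamOn (LupC hg) (JL hg) (emap hg ((wPath hg).trans (merid hg)) (VanKampen.trans_mem (wPath_mem hg) (merid_mem hg))) _ _
  rw [emap_trans hg (wPath hg) (merid hg) (wPath_mem hg) (merid_mem hg)]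
  exact (isParamOn_emap_wPath hg).trans (isParamOn_emap_merid hg)

/-- The four pieces of the valley arc. [folklore] -/
def vPiece₁ (hg : 2 ≤ g) : Path (vC hg 0) (vC hg (rt g 7)) := epath (vC hg) 0 (rt g 7)
/-- Auxiliary definition for the boundary-word computation (`vPiece₂`). [folklore] -/
def vPiece₂ (hg : 2 ≤ g) : Path (vC hg (rt g 7)) (vC hg (rho4 hg)) := epath (vC hg) (rt g 7) (rho4 hg)
/-- Auxiliary definition for the boundary-word computation (`vPiece₃`). [folklore] -/
def vPiece₃ (hg : 2 ≤ g) : Path (vC hg (rho4 hg)) (vC hg (2 * rho4 hg - rt g 7)) := epath (vC hg) (rho4 hg) (2 * rho4 hg - rt g 7)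
/-- Auxiliary definition for the boundary-word computation (`vPiece₄`). [folklore] -/
def vPiece₄ (hg : 2 ≤ g) : Path (vC hg (2 * rho4 hg - rt g 7)) (vC hg (2 * rho4 hg)) := epath (vC hg) (2 * rho4 hg - rt g 7) (2 * rho4 hg)

/-- Bookkeeping for the boundary-word computation (`vPiece₁_mem`). [folklore] -/
theorem vPiece₁_mem (hg : 2 ≤ g) (t : I) : vPiece₁ hg t ∈ sectorZ g :=
  epath_mem (convex_JV hg) (mapsTo_vC hg) (zero_mem_JV hg) (rt_seven_mem_JV hg) t
/-- Bookkeeping for the boundary-word computation (`vPiece₂_mem`). [folklore] -/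
theorem vPiece₂_mem (hg : 2 ≤ g) (t : I) : vPiece₂ hg t ∈ sectorZ g :=
  epath_mem (convex_JV hg) (mapsTo_vC hg) (rt_seven_mem_JV hg) (rho4_mem_JV hg) t
/-- Bookkeeping for the boundary-word computation (`vPiece₃_mem`). [folklore] -/
theorem vPiece₃_mem (hg : 2 ≤ g) (t : I) : vPiece₃ hg t ∈ sectorZ g :=
  epath_mem (convex_JV hg) (mapsTo_vC hg) (rho4_mem_JV hg) (sub_rt_seven_mem_JV hg) t
/-- Bookkeeping for the boundary-word computation (`vPiece₄_mem`). [folklore] -/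
theorem vPiece₄_mem (hg : 2 ≤ g) (t : I) : vPiece₄ hg t ∈ sectorZ g :=
  epath_mem (convex_JV hg) (mapsTo_vC hg) (sub_rt_seven_mem_JV hg) (two_mul_mem_JV hg) t

/-- **The valley arc in four pieces.** [folklore] -/
def vFour (hg : 2 ≤ g) : Path (vC hg 0) (vC hg (2 * rho4 hg)) :=
  ((vPiece₁ hg).trans (vPiece₂ hg)).trans ((vPiece₃ hg).trans (vPiece₄ hg))

/-- Bookkeeping for the boundary-word computation (`vFour_mem`). [folklore] -/
theorem vFour_mem (hg : 2 ≤ g) (t : I) : vFour hg t ∈ sectorZ g :=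
  VanKampen.trans_mem (VanKampen.trans_mem (vPiece₁_mem hg) (vPiece₂_mem hg))
    (VanKampen.trans_mem (vPiece₃_mem hg) (vPiece₄_mem hg)) t

/-- The valley arc in four pieces, as a path from pole to pole. [folklore] -/
def vFourC (hg : 2 ≤ g) : Path (top g) (bot g) := (vFour hg).cast (vArcFun_zero hg).symm (vArcFun_two_mul hg).symm

/-- Bookkeeping for the boundary-word computation (`vFourC_mem`). [folklore] -/
theorem vFourC_mem (hg : 2 ≤ g) (t : I) : vFourC hg t ∈ sectorZ g := by
  rw [vFourC, Path.cast_coe]; exact vFour_mem hg t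

/-- Bookkeeping for the boundary-word computation (`isParamOn_vFourC`). [folklore] -/
theorem isParamOn_vFourC (hg : 2 ≤ g) : IsParamOn (vC hg) (JV hg) (vFourC hg) 0 (2 * rho4 hg) :=
  ((((isParamOn_epath _ (convex_JV hg) (zero_mem_JV hg) (rt_seven_mem_JV hg)).trans
    (isParamOn_epath _ (convex_JV hg) (rt_seven_mem_JV hg) (rho4_mem_JV hg))).trans
    ((isParamOn_epath _ (convex_JV hg) (rho4_mem_JV hg) (sub_rt_seven_mem_JV hg)).trans
    (isParamOn_epath _ (convex_JV hg) (sub_rt_seven_mem_JV hg) (two_mul_mem_JV hg)))).cast _ _)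

/-- Bookkeeping for the boundary-word computation (`isParamOn_vArc`). [folklore] -/
theorem isParamOn_vArc (hg : 2 ≤ g) : IsParamOn (vC hg) (JV hg) (vArc hg) 0 (2 * rho4 hg) := by
  have h4 := rho4_pos hg
  exact isParamOn_of_forall (fun t => 2 * rho4 hg * t) (by fun_prop)
    (fun t => show 2 * rho4 hg * (t : ℝ) ∈ Icc (0 : ℝ) (2 * rho4 hg) from ⟨by nlinarith [t.2.1], by nlinarith [t.2.2]⟩)
    (fun t => rfl) (by simp) (by simp)

/-- **The valley arc is homotopic, inside the sector, to its four-piece form.** [folklore] -/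
theorem cl_vArc_eq (hg : 2 ≤ g) : cl (vArc hg) (vArc_mem_sectorZ hg) = cl (vFourC hg) (vFourC_mem hg) :=
  (isParamOn_vArc hg).mk_liftPath_eq (convex_JV hg) (vC hg).continuous.continuousOn (mapsTo_vC hg)
    (isParamOn_vFourC hg) _ _

/-- The mirror fixes the upper pole. [folklore] -/
theorem refl3_top (g : ℕ) : refl3 (top g) = top g := by
  rw [top, refl3_apply, map_add, map_smul, proj_lift, proj_ez, smul_zero, add_zero, map_zero]
  simp

/-- The mirror fixes the lower pole. [folklore] -/
theorem refl3_bot (g : ℕ) : refl3 (bot g) = bot g := by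
  rw [bot, refl3_apply, map_add, map_smul, proj_lift, proj_ez, smul_zero, add_zero, map_zero]
  simp

/-- **The mirrored valley arc** (over the ray `θ = -π/g`), as a path from pole to pole. [folklore] -/
def vArcR (hg : 2 ≤ g) : Path (top g) (bot g) :=
  ((vArc hg).map refl3.continuous).cast (refl3_top g).symm (refl3_bot g).symm

/-- Bookkeeping for the boundary-word computation (`refl3_vC_zero`). [folklore] -/
theorem refl3_vC_zero (hg : 2 ≤ g) : top g = refl3 (vC hg 0) := by rw [vC_apply, vArcFun_zero, refl3_top]
/-- Bookkeeping for the boundary-word computation (`refl3_vC_two_mul`). [folklore] -/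
theorem refl3_vC_two_mul (hg : 2 ≤ g) : bot g = refl3 (vC hg (2 * rho4 hg)) := by rw [vC_apply, vArcFun_two_mul, refl3_bot]

/-- The mirrored four-piece valley arc, as a concatenation of the four mirrored pieces. [folklore] -/
def vFourRraw (hg : 2 ≤ g) : Path (refl3 (vC hg 0)) (refl3 (vC hg (2 * rho4 hg))) :=
  (((vPiece₁ hg).map refl3.continuous).trans ((vPiece₂ hg).map refl3.continuous)).trans
    (((vPiece₃ hg).map refl3.continuous).trans ((vPiece₄ hg).map refl3.continuous))

/-- The mirrored four-piece valley arc, as a path from pole to pole. [folklore] -/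
def vFourR (hg : 2 ≤ g) : Path (top g) (bot g) := (vFourRraw hg).cast (refl3_vC_zero hg) (refl3_vC_two_mul hg)

/-- Bookkeeping for the boundary-word computation (`map_refl3_mem`). [folklore] -/
theorem map_refl3_mem {a b : 𝔼 3} {p : Path a b} (hp : ∀ t, p t ∈ sectorZ g) (hg : 2 ≤ g) (t : I) :
    p.map refl3.continuous t ∈ sectorZ g := refl3_mem_sectorZ hg (hp t)

/-- Bookkeeping for the boundary-word computation (`vArcR_mem`). [folklore] -/
theorem vArcR_mem (hg : 2 ≤ g) (t : I) : vArcR hg t ∈ sectorZ g := by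
  rw [vArcR, Path.cast_coe]; exact map_refl3_mem (vArc_mem_sectorZ hg) hg t

/-- Bookkeeping for the boundary-word computation (`vFourRraw_mem`). [folklore] -/
theorem vFourRraw_mem (hg : 2 ≤ g) (t : I) : vFourRraw hg t ∈ sectorZ g :=
  VanKampen.trans_mem (VanKampen.trans_mem (map_refl3_mem (vPiece₁_mem hg) hg) (map_refl3_mem (vPiece₂_mem hg) hg))
    (VanKampen.trans_mem (map_refl3_mem (vPiece₃_mem hg) hg) (map_refl3_mem (vPiece₄_mem hg) hg)) t

/-- Bookkeeping for the boundary-word computation (`vFourR_mem`). [folklore] -/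
theorem vFourR_mem (hg : 2 ≤ g) (t : I) : vFourR hg t ∈ sectorZ g := by
  rw [vFourR, Path.cast_coe]; exact vFourRraw_mem hg t

/-- Bookkeeping for the boundary-word computation (`isParamOn_vFourR`). [folklore] -/
theorem isParamOn_vFourR (hg : 2 ≤ g) : IsParamOn (⇑refl3 ∘ ⇑(vC hg)) (JV hg) (vFourR hg) 0 (2 * rho4 hg) :=
  (((((isParamOn_epath _ (convex_JV hg) (zero_mem_JV hg) (rt_seven_mem_JV hg)).map refl3.continuous).trans
    ((isParamOn_epath _ (convex_JV hg) (rt_seven_mem_JV hg) (rho4_mem_JV hg)).map refl3.continuous)).trans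
    (((isParamOn_epath _ (convex_JV hg) (rho4_mem_JV hg) (sub_rt_seven_mem_JV hg)).map refl3.continuous).trans
    ((isParamOn_epath _ (convex_JV hg) (sub_rt_seven_mem_JV hg) (two_mul_mem_JV hg)).map refl3.continuous))).cast _ _)

/-- **The mirrored valley arc is homotopic, inside the sector, to its four-piece form.** [folklore] -/
theorem cl_vArcR_eq (hg : 2 ≤ g) : cl (vArcR hg) (vArcR_mem hg) = cl (vFourR hg) (vFourR_mem hg) :=
  (((isParamOn_vArc hg).map refl3.continuous).cast _ _).mk_liftPath_eq (convex_JV hg)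
    (refl3.continuous.comp (vC hg).continuous).continuousOn (fun _ hs => refl3_mem_sectorZ hg (mapsTo_vC hg hs))
    (isParamOn_vFourR hg) _ _

/-! ### §6 The end map on the four pieces of the valley arc -/

/-- Piece 1 (`0 ≤ s ≤ 7^{1/20g}`, upper sheet) reads `x`: an `Lup`-piece from `ρ₁` to `7^{1/20g}`. [folklore] -/
theorem isParamOn_emap_vPiece₁ (hg : 2 ≤ g) :
    IsParamOn (LupC hg) (JL hg) (emap hg (vPiece₁ hg) (vPiece₁_mem hg)) (rho1 hg) (rt g 7) := by
  have h7 := rt_pos (g := g) (by norm_num : (0:ℝ) < 7)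
  have h17 := rho1_lt_rt_seven hg
  refine isParamOn_of_forall (fun t => max (rho1 hg) (0 + (rt g 7 - 0) * t)) (by fun_prop) (fun t => ?_) (fun t => ?_) ?_ ?_
  · exact show max (rho1 hg) (0 + (rt g 7 - 0) * (t : ℝ)) ∈ Icc (rho1 hg) (rt g 7) from
      ⟨le_max_left _ _, max_le h17.le (by nlinarith [t.2.2])⟩
  · show endMapI hg (vArcFun hg (0 + (rt g 7 - 0) * t)) = Lup g (max (rho1 hg) (0 + (rt g 7 - 0) * t))
    rw [endMapI_def, endMap_vArcFun_low hg (by nlinarith [t.2.1]) (by nlinarith [t.2.2])]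
  · simp only [Set.Icc.coe_zero, mul_zero, add_zero]; exact max_eq_left (rho1_pos hg).le
  · simp only [Set.Icc.coe_one, mul_one, zero_add, sub_zero]; exact max_eq_right h17.le

/-- Piece 2 (`7^{1/20g} ≤ s ≤ ρ₄`, upper sheet) reads `u`: a `Cup`-piece from `7^{1/20g}` to `ρ₃`. [folklore] -/
theorem isParamOn_emap_vPiece₂ (hg : 2 ≤ g) :
    IsParamOn (CupC g) (JC hg) (emap hg (vPiece₂ hg) (vPiece₂_mem hg)) (rt g 7) (rho3 hg) := by
  have h74 := rt_seven_lt_rho4 hg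
  have h73 := rt_seven_lt_rho3 hg
  have h34 := rho3_lt_rho4 hg
  refine isParamOn_of_forall (fun t => min (rt g 7 + (rho4 hg - rt g 7) * t) (rho3 hg)) (by fun_prop) (fun t => ?_) (fun t => ?_) ?_ ?_
  · exact show min (rt g 7 + (rho4 hg - rt g 7) * (t : ℝ)) (rho3 hg) ∈ Icc (rt g 7) (rho3 hg) from
      ⟨le_min (by nlinarith [t.2.1]) h73.le, min_le_right _ _⟩
  · show endMapI hg (vArcFun hg (rt g 7 + (rho4 hg - rt g 7) * t)) = Cup g (min (rt g 7 + (rho4 hg - rt g 7) * t) (rho3 hg))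
    rw [endMapI_def, endMap_vArcFun_mid hg (by nlinarith [t.2.1]) (by nlinarith [t.2.2])]
  · simp only [Set.Icc.coe_zero, mul_zero, add_zero]; exact min_eq_left h73.le
  · simp only [Set.Icc.coe_one, mul_one, add_sub_cancel]; exact min_eq_right h34.le

/-- Piece 3 (`ρ₄ ≤ s ≤ 2ρ₄ - 7^{1/20g}`, lower sheet, radius decreasing) reads `d⁻¹`: a `Cdn`-piece
from `ρ₃` to `7^{1/20g}`. [folklore] -/
theorem isParamOn_emap_vPiece₃ (hg : 2 ≤ g) :
    IsParamOn (CdnC g) (JC hg) (emap hg (vPiece₃ hg) (vPiece₃_mem hg)) (rho3 hg) (rt g 7) := by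
  have h74 := rt_seven_lt_rho4 hg
  have h73 := rt_seven_lt_rho3 hg
  have h34 := rho3_lt_rho4 hg
  refine isParamOn_of_forall (fun t => min (2 * rho4 hg - (rho4 hg + (2 * rho4 hg - rt g 7 - rho4 hg) * t)) (rho3 hg))
    (by fun_prop) (fun t => ?_) (fun t => ?_) ?_ ?_
  · exact show min (2 * rho4 hg - (rho4 hg + (2 * rho4 hg - rt g 7 - rho4 hg) * (t : ℝ))) (rho3 hg) ∈ Icc (rt g 7) (rho3 hg) from
      ⟨le_min (by nlinarith [t.2.2]) h73.le, min_le_right _ _⟩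
  · show endMapI hg (vArcFun hg (rho4 hg + (2 * rho4 hg - rt g 7 - rho4 hg) * t)) =
      Cdn g (min (2 * rho4 hg - (rho4 hg + (2 * rho4 hg - rt g 7 - rho4 hg) * t)) (rho3 hg))
    rw [endMapI_def, endMap_vArcFun_mid' hg (by nlinarith [t.2.1]) (by nlinarith [t.2.2])]
  · simp only [Set.Icc.coe_zero, mul_zero, add_zero]
    rw [show 2 * rho4 hg - rho4 hg = rho4 hg by ring]; exact min_eq_right h34.le
  · simp only [Set.Icc.coe_one, mul_one]
    rw [show 2 * rho4 hg - (rho4 hg + (2 * rho4 hg - rt g 7 - rho4 hg)) = rt g 7 by ring]; exact min_eq_left h73.le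

/-- Piece 4 (`2ρ₄ - 7^{1/20g} ≤ s ≤ 2ρ₄`, lower sheet) reads `x⁻¹`: an `Lup`-piece from `7^{1/20g}`
to `ρ₁`. [folklore] -/
theorem isParamOn_emap_vPiece₄ (hg : 2 ≤ g) :
    IsParamOn (LupC hg) (JL hg) (emap hg (vPiece₄ hg) (vPiece₄_mem hg)) (rt g 7) (rho1 hg) := by
  have h7 := rt_pos (g := g) (by norm_num : (0:ℝ) < 7)
  have h17 := rho1_lt_rt_seven hg
  refine isParamOn_of_forall (fun t => max (rho1 hg) (2 * rho4 hg - (2 * rho4 hg - rt g 7 + (2 * rho4 hg - (2 * rho4 hg - rt g 7)) * t)))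
    (by fun_prop) (fun t => ?_) (fun t => ?_) ?_ ?_
  · exact show max (rho1 hg) (2 * rho4 hg - (2 * rho4 hg - rt g 7 + (2 * rho4 hg - (2 * rho4 hg - rt g 7)) * (t : ℝ))) ∈
        Icc (rho1 hg) (rt g 7) from ⟨le_max_left _ _, max_le h17.le (by nlinarith [t.2.1])⟩
  · show endMapI hg (vArcFun hg (2 * rho4 hg - rt g 7 + (2 * rho4 hg - (2 * rho4 hg - rt g 7)) * t)) =
      Lup g (max (rho1 hg) (2 * rho4 hg - (2 * rho4 hg - rt g 7 + (2 * rho4 hg - (2 * rho4 hg - rt g 7)) * t)))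
    rw [endMapI_def, endMap_vArcFun_top hg (by nlinarith [t.2.1]) (by nlinarith [t.2.2])]
  · simp only [Set.Icc.coe_zero, mul_zero, add_zero]
    rw [show 2 * rho4 hg - (2 * rho4 hg - rt g 7) = rt g 7 by ring]; exact max_eq_right h17.le
  · simp only [Set.Icc.coe_one, mul_one]
    rw [show 2 * rho4 hg - (2 * rho4 hg - rt g 7 + (2 * rho4 hg - (2 * rho4 hg - rt g 7))) = 0 by ring]
    exact max_eq_left (rho1_pos hg).le

/-- Mirrored `Lup`-pieces are `Ldn`-pieces. [folklore] -/
theorem isParamOn_map_refl3_of_Lup (hg : 2 ≤ g) {a b : 𝔼 3} {p : Path a b} {u v : ℝ} (h : IsParamOn (LupC hg) (JL hg) p u v) :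
    IsParamOn (LdnC hg) (JL hg) (p.map refl3.continuous) u v :=
  (h.map refl3.continuous).congr fun r _ => refl3_Lup r

/-- Mirrored `Cup`-pieces are `Cup`-pieces. [folklore] -/
theorem isParamOn_map_refl3_of_Cup (hg : 2 ≤ g) {a b : 𝔼 3} {p : Path a b} {u v : ℝ} (h : IsParamOn (CupC g) (JC hg) p u v) :
    IsParamOn (CupC g) (JC hg) (p.map refl3.continuous) u v :=
  (h.map refl3.continuous).congr fun r _ => refl3_Cup r

/-- Mirrored `Cdn`-pieces are `Cdn`-pieces. [folklore] -/
theorem isParamOn_map_refl3_of_Cdn (hg : 2 ≤ g) {a b : 𝔼 3} {p : Path a b} {u v : ℝ} (h : IsParamOn (CdnC g) (JC hg) p u v) :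
    IsParamOn (CdnC g) (JC hg) (p.map refl3.continuous) u v :=
  (h.map refl3.continuous).congr fun r _ => refl3_Cdn r

/-! ### §7 Splitting classes of composite paths -/

section Split

variable {a b c : 𝔼 3}

/-- Bookkeeping for the boundary-word computation (`mem_left_of_trans_mem`). [folklore] -/
theorem mem_left_of_trans_mem {p : Path a b} {q : Path b c} (h : ∀ t, (p.trans q) t ∈ sectorZ g) (t : I) :
    p t ∈ sectorZ g := by
  have hr : range (p.trans q) ⊆ sectorZ g := range_subset_iff.2 h
  rw [Path.trans_range] at hr
  exact hr (Or.inl ⟨t, rfl⟩)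

/-- Bookkeeping for the boundary-word computation (`mem_right_of_trans_mem`). [folklore] -/
theorem mem_right_of_trans_mem {p : Path a b} {q : Path b c} (h : ∀ t, (p.trans q) t ∈ sectorZ g) (t : I) :
    q t ∈ sectorZ g := by
  have hr : range (p.trans q) ⊆ sectorZ g := range_subset_iff.2 h
  rw [Path.trans_range] at hr
  exact hr (Or.inr ⟨t, rfl⟩)

/-- Bookkeeping for the boundary-word computation (`mem_of_symm_mem`). [folklore] -/
theorem mem_of_symm_mem {p : Path a b} (h : ∀ t, p.symm t ∈ sectorZ g) (t : I) : p t ∈ sectorZ g := by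
  have hr : range p.symm ⊆ sectorZ g := range_subset_iff.2 h
  rw [Path.symm_range] at hr
  exact hr ⟨t, rfl⟩

/-- Bookkeeping for the boundary-word computation (`mem_of_map_refl3_mem`). [folklore] -/
theorem mem_of_map_refl3_mem (hg : 2 ≤ g) {p : Path a b} (h : ∀ t, p.map refl3.continuous t ∈ sectorZ g) (t : I) :
    p t ∈ sectorZ g := by
  have := refl3_mem_sectorZ hg (h t)
  rwa [Path.map_coe, Function.comp_apply, refl3_refl3] at this

/-- Classes of equal paths agree. [folklore] -/
theorem cl_congr {p q : Path a b} (hpq : p = q) (hp : ∀ t, p t ∈ sectorZ g) (hq : ∀ t, q t ∈ sectorZ g) :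
    cl p hp = cl q hq := by
  subst hpq; rfl

/-- Splitting a concatenation. [folklore] -/
theorem cl_trans_split (p : Path a b) (q : Path b c) (h : ∀ t, (p.trans q) t ∈ sectorZ g) :
    cl (p.trans q) h = (cl p (mem_left_of_trans_mem h)).trans (cl q (mem_right_of_trans_mem h)) := by
  rw [cl_trans]

/-- Splitting a reversal. [folklore] -/
theorem cl_symm_split (p : Path a b) (h : ∀ t, p.symm t ∈ sectorZ g) :
    cl p.symm h = (cl p (mem_of_symm_mem h)).symm := by
  rw [cl_symm]

/-- Splitting a cast (the membership proof of the uncast path may be chosen freely). [folklore] -/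
theorem cl_cast_split {a' b' : 𝔼 3} (p : Path a b) (hp : ∀ t, p t ∈ sectorZ g) (ha : a' = a) (hb : b' = b)
    (h : ∀ t, p.cast ha hb t ∈ sectorZ g) :
    cl (p.cast ha hb) h = (cl p hp).cast (Subtype.ext ha) (Subtype.ext hb) := by
  subst ha hb; rfl

/-- Splitting the end map of a concatenation. [folklore] -/
theorem cl_emap_trans (hg : 2 ≤ g) (p : Path a b) (q : Path b c) (hp : ∀ t, p t ∈ sectorZ g)
    (hq : ∀ t, q t ∈ sectorZ g) (h' : ∀ t, emap hg (p.trans q) (VanKampen.trans_mem hp hq) t ∈ sectorZ g) :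
    cl (emap hg (p.trans q) (VanKampen.trans_mem hp hq)) h' =
      (cl (emap hg p hp) (emap_mem hg p hp)).trans (cl (emap hg q hq) (emap_mem hg q hq)) := by
  rw [cl_trans]
  exact cl_congr (emap_trans hg p q hp hq) _ _

/-- Splitting the end map of a reversal. [folklore] -/
theorem cl_emap_symm (hg : 2 ≤ g) (p : Path a b) (hp : ∀ t, p t ∈ sectorZ g)
    (h' : ∀ t, emap hg p.symm (VanKampen.symm_mem hp) t ∈ sectorZ g) :
    cl (emap hg p.symm (VanKampen.symm_mem hp)) h' = (cl (emap hg p hp) (emap_mem hg p hp)).symm := by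
  rw [cl_symm]
  exact cl_congr (emap_symm hg p hp) _ _

/-- Splitting the end map of a cast (the membership proof of the uncast path may be chosen freely). [folklore] -/
theorem cl_emap_cast (hg : 2 ≤ g) {a' b' : 𝔼 3} (p : Path a b) (hp : ∀ t, p t ∈ sectorZ g) (ha : a' = a) (hb : b' = b)
    (h : ∀ t, p.cast ha hb t ∈ sectorZ g) (h' : ∀ t, emap hg (p.cast ha hb) h t ∈ sectorZ g) :
    cl (emap hg (p.cast ha hb) h) h' =
      (cl (emap hg p hp) (emap_mem hg p hp)).cast (Subtype.ext (congrArg (endMapI hg) ha))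
        (Subtype.ext (congrArg (endMapI hg) hb)) := by
  subst ha hb; rfl

/-- Splitting the end map of a mirrored path. [folklore] -/
theorem cl_emap_map_refl3 (hg : 2 ≤ g) (p : Path a b) (hp : ∀ t, p t ∈ sectorZ g)
    (h' : ∀ t, emap hg (p.map refl3.continuous) (map_refl3_mem hp hg) t ∈ sectorZ g) :
    cl (emap hg (p.map refl3.continuous) (map_refl3_mem hp hg)) h' =
      (cl ((emap hg p hp).map refl3.continuous) (map_refl3_mem (emap_mem hg p hp) hg)).cast
        (Subtype.ext (endMapI_refl3 hg (p.source ▸ hp 0))) (Subtype.ext (endMapI_refl3 hg (p.target ▸ hp 1))) := by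
  rw [← cl_cast]
  exact cl_congr (emap_map_refl3 hg p hp (map_refl3_mem hp hg)) _ _

end Split

/-- The end map of the upper pole is `I`. [folklore] -/
theorem endMap_top (hg : 2 ≤ g) : endMapI hg (top g) = ptI hg := by
  rw [endMapI_def, ← vArcFun_zero hg, endMap_vArcFun_low hg le_rfl (rt_pos (by norm_num)).le, max_eq_left (rho1_pos hg).le, Lup_rho1]

/-- The end map of the lower pole is `I`. [folklore] -/
theorem endMap_bot (hg : 2 ≤ g) : endMapI hg (bot g) = ptI hg := by
  rw [endMapI_def, ← vArcFun_two_mul hg, endMap_vArcFun_top hg (by linarith [rt_pos (g := g) (by norm_num : (0:ℝ) < 7)]) le_rfl, sub_self,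
    max_eq_left (rho1_pos hg).le, Lup_rho1]

/-- The mirror fixes `I`, `P`, `Q`. [folklore] -/
theorem refl3_ptI (hg : 2 ≤ g) : refl3 (ptI hg) = ptI hg := by rw [ptI, refl3_lift, refl_ax]
/-- Bookkeeping for the boundary-word computation (`refl3_ptP`). [folklore] -/
theorem refl3_ptP (g : ℕ) : refl3 (ptP g) = ptP g := by rw [ptP, refl3_lift, refl_ax]
/-- Bookkeeping for the boundary-word computation (`refl3_ptQ`). [folklore] -/
theorem refl3_ptQ (hg : 2 ≤ g) : refl3 (ptQ hg) = ptQ hg := by rw [ptQ, refl3_lift, refl_ax]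

/-! ### §8 The pieces, read as atoms -/

/-- Bookkeeping for the boundary-word computation (`cl_emap_gam`). [folklore] -/
theorem cl_emap_gam (hg : 2 ≤ g) (h : ∀ t, gam hg t ∈ sectorZ g) (h' : ∀ t, emap hg (gam hg) h t ∈ sectorZ g) :
    cl (emap hg (gam hg) h) h' = (atomX hg).cast (Subtype.ext (endMap_top hg)) (Subtype.ext (endMap_ptP hg)) :=
  cl_eq_atomX hg h' (isParamOn_emap_gam hg) (endMap_top hg) (endMap_ptP hg)

/-- Bookkeeping for the boundary-word computation (`endMap_vC_zero`). [folklore] -/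
theorem endMap_vC_zero (hg : 2 ≤ g) : endMapI hg (vC hg 0) = ptI hg := by rw [vC_apply, vArcFun_zero, endMap_top]
/-- Bookkeeping for the boundary-word computation (`endMap_vC_rt_seven`). [folklore] -/
theorem endMap_vC_rt_seven (hg : 2 ≤ g) : endMapI hg (vC hg (rt g 7)) = ptP g := by
  have := (isParamOn_emap_vPiece₁ hg).target_eq; rw [LupC_apply, Lup_rt_seven hg] at this; exact this
/-- Bookkeeping for the boundary-word computation (`endMap_vC_rho4`). [folklore] -/
theorem endMap_vC_rho4 (hg : 2 ≤ g) : endMapI hg (vC hg (rho4 hg)) = ptQ hg := by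
  have := (isParamOn_emap_vPiece₂ hg).target_eq; rw [CupC_apply, Cup_rho3] at this; exact this
/-- Bookkeeping for the boundary-word computation (`endMap_vC_sub`). [folklore] -/
theorem endMap_vC_sub (hg : 2 ≤ g) : endMapI hg (vC hg (2 * rho4 hg - rt g 7)) = ptP g := by
  have := (isParamOn_emap_vPiece₃ hg).target_eq; rw [CdnC_apply, Cdn_rt_seven] at this; exact this
/-- Bookkeeping for the boundary-word computation (`endMap_vC_two_mul`). [folklore] -/
theorem endMap_vC_two_mul (hg : 2 ≤ g) : endMapI hg (vC hg (2 * rho4 hg)) = ptI hg := by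
  rw [vC_apply, vArcFun_two_mul, endMap_bot]

/-- Bookkeeping for the boundary-word computation (`cl_emap_vPiece₁`). [folklore] -/
theorem cl_emap_vPiece₁ (hg : 2 ≤ g) (h : ∀ t, vPiece₁ hg t ∈ sectorZ g) (h' : ∀ t, emap hg (vPiece₁ hg) h t ∈ sectorZ g) :
    cl (emap hg (vPiece₁ hg) h) h' = (atomX hg).cast (Subtype.ext (endMap_vC_zero hg)) (Subtype.ext (endMap_vC_rt_seven hg)) :=
  cl_eq_atomX hg h' (isParamOn_emap_vPiece₁ hg) (endMap_vC_zero hg) (endMap_vC_rt_seven hg)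

/-- Bookkeeping for the boundary-word computation (`cl_emap_vPiece₂`). [folklore] -/
theorem cl_emap_vPiece₂ (hg : 2 ≤ g) (h : ∀ t, vPiece₂ hg t ∈ sectorZ g) (h' : ∀ t, emap hg (vPiece₂ hg) h t ∈ sectorZ g) :
    cl (emap hg (vPiece₂ hg) h) h' = (atomU hg).cast (Subtype.ext (endMap_vC_rt_seven hg)) (Subtype.ext (endMap_vC_rho4 hg)) :=
  cl_eq_atomU hg h' (isParamOn_emap_vPiece₂ hg) (endMap_vC_rt_seven hg) (endMap_vC_rho4 hg)

/-- Bookkeeping for the boundary-word computation (`cl_emap_vPiece₃`). [folklore] -/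
theorem cl_emap_vPiece₃ (hg : 2 ≤ g) (h : ∀ t, vPiece₃ hg t ∈ sectorZ g) (h' : ∀ t, emap hg (vPiece₃ hg) h t ∈ sectorZ g) :
    cl (emap hg (vPiece₃ hg) h) h' = (atomD hg).symm.cast (Subtype.ext (endMap_vC_rho4 hg)) (Subtype.ext (endMap_vC_sub hg)) :=
  cl_eq_atomD_symm hg h' (isParamOn_emap_vPiece₃ hg) (endMap_vC_rho4 hg) (endMap_vC_sub hg)

/-- Bookkeeping for the boundary-word computation (`cl_emap_vPiece₄`). [folklore] -/
theorem cl_emap_vPiece₄ (hg : 2 ≤ g) (h : ∀ t, vPiece₄ hg t ∈ sectorZ g) (h' : ∀ t, emap hg (vPiece₄ hg) h t ∈ sectorZ g) :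
    cl (emap hg (vPiece₄ hg) h) h' = (atomX hg).symm.cast (Subtype.ext (endMap_vC_sub hg)) (Subtype.ext (endMap_vC_two_mul hg)) :=
  cl_eq_atomX_symm hg h' (isParamOn_emap_vPiece₄ hg) (endMap_vC_sub hg) (endMap_vC_two_mul hg)

/-- Bookkeeping for the boundary-word computation (`refl3_endMap_vC_zero`). [folklore] -/
theorem refl3_endMap_vC_zero (hg : 2 ≤ g) : refl3 (endMapI hg (vC hg 0)) = ptI hg := by rw [endMap_vC_zero, refl3_ptI]
/-- Bookkeeping for the boundary-word computation (`refl3_endMap_vC_rt_seven`). [folklore] -/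
theorem refl3_endMap_vC_rt_seven (hg : 2 ≤ g) : refl3 (endMapI hg (vC hg (rt g 7))) = ptP g := by rw [endMap_vC_rt_seven, refl3_ptP]
/-- Bookkeeping for the boundary-word computation (`refl3_endMap_vC_rho4`). [folklore] -/
theorem refl3_endMap_vC_rho4 (hg : 2 ≤ g) : refl3 (endMapI hg (vC hg (rho4 hg))) = ptQ hg := by rw [endMap_vC_rho4, refl3_ptQ]
/-- Bookkeeping for the boundary-word computation (`refl3_endMap_vC_sub`). [folklore] -/
theorem refl3_endMap_vC_sub (hg : 2 ≤ g) : refl3 (endMapI hg (vC hg (2 * rho4 hg - rt g 7))) = ptP g := by rw [endMap_vC_sub, refl3_ptP]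
/-- Bookkeeping for the boundary-word computation (`refl3_endMap_vC_two_mul`). [folklore] -/
theorem refl3_endMap_vC_two_mul (hg : 2 ≤ g) : refl3 (endMapI hg (vC hg (2 * rho4 hg))) = ptI hg := by rw [endMap_vC_two_mul, refl3_ptI]

/-- Bookkeeping for the boundary-word computation (`cl_refl3_emap_vPiece₁`). [folklore] -/
theorem cl_refl3_emap_vPiece₁ (hg : 2 ≤ g) (h : ∀ t, vPiece₁ hg t ∈ sectorZ g)
    (h' : ∀ t, (emap hg (vPiece₁ hg) h).map refl3.continuous t ∈ sectorZ g) :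
    cl ((emap hg (vPiece₁ hg) h).map refl3.continuous) h' =
      (atomY hg).cast (Subtype.ext (refl3_endMap_vC_zero hg)) (Subtype.ext (refl3_endMap_vC_rt_seven hg)) :=
  cl_eq_atomY hg h' (isParamOn_map_refl3_of_Lup hg (isParamOn_emap_vPiece₁ hg)) (refl3_endMap_vC_zero hg) (refl3_endMap_vC_rt_seven hg)

/-- Bookkeeping for the boundary-word computation (`cl_refl3_emap_vPiece₂`). [folklore] -/
theorem cl_refl3_emap_vPiece₂ (hg : 2 ≤ g) (h : ∀ t, vPiece₂ hg t ∈ sectorZ g)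
    (h' : ∀ t, (emap hg (vPiece₂ hg) h).map refl3.continuous t ∈ sectorZ g) :
    cl ((emap hg (vPiece₂ hg) h).map refl3.continuous) h' =
      (atomU hg).cast (Subtype.ext (refl3_endMap_vC_rt_seven hg)) (Subtype.ext (refl3_endMap_vC_rho4 hg)) :=
  cl_eq_atomU hg h' (isParamOn_map_refl3_of_Cup hg (isParamOn_emap_vPiece₂ hg)) (refl3_endMap_vC_rt_seven hg) (refl3_endMap_vC_rho4 hg)

/-- Bookkeeping for the boundary-word computation (`cl_refl3_emap_vPiece₃`). [folklore] -/
theorem cl_refl3_emap_vPiece₃ (hg : 2 ≤ g) (h : ∀ t, vPiece₃ hg t ∈ sectorZ g)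
    (h' : ∀ t, (emap hg (vPiece₃ hg) h).map refl3.continuous t ∈ sectorZ g) :
    cl ((emap hg (vPiece₃ hg) h).map refl3.continuous) h' =
      (atomD hg).symm.cast (Subtype.ext (refl3_endMap_vC_rho4 hg)) (Subtype.ext (refl3_endMap_vC_sub hg)) :=
  cl_eq_atomD_symm hg h' (isParamOn_map_refl3_of_Cdn hg (isParamOn_emap_vPiece₃ hg)) (refl3_endMap_vC_rho4 hg) (refl3_endMap_vC_sub hg)

/-- Bookkeeping for the boundary-word computation (`cl_refl3_emap_vPiece₄`). [folklore] -/
theorem cl_refl3_emap_vPiece₄ (hg : 2 ≤ g) (h : ∀ t, vPiece₄ hg t ∈ sectorZ g)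
    (h' : ∀ t, (emap hg (vPiece₄ hg) h).map refl3.continuous t ∈ sectorZ g) :
    cl ((emap hg (vPiece₄ hg) h).map refl3.continuous) h' =
      (atomY hg).symm.cast (Subtype.ext (refl3_endMap_vC_sub hg)) (Subtype.ext (refl3_endMap_vC_two_mul hg)) :=
  cl_eq_atomY_symm hg h' (isParamOn_map_refl3_of_Lup hg (isParamOn_emap_vPiece₄ hg)) (refl3_endMap_vC_sub hg) (refl3_endMap_vC_two_mul hg)

/-! ### §9 The boundary loop read through the end map -/

/-- The word of the mirrored four-piece arc under the end map: `y u d⁻¹ y⁻¹` (cast). [folklore] -/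
theorem cl_emap_vFourR (hg : 2 ≤ g) (h' : ∀ t, emap hg (vFourR hg) (vFourR_mem hg) t ∈ sectorZ g) :
    cl (emap hg (vFourR hg) (vFourR_mem hg)) h' =
      (((atomY hg).trans (atomU hg)).trans ((atomD hg).symm.trans (atomY hg).symm)).cast
        (Subtype.ext (endMap_top hg)) (Subtype.ext (endMap_bot hg)) := by
  show cl (emap hg ((vFourRraw hg).cast (refl3_vC_zero hg) (refl3_vC_two_mul hg)) (vFourR_mem hg)) h' = _
  rw [cl_emap_cast hg (vFourRraw hg) (vFourRraw_mem hg)]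
  show (cl (emap hg ((((vPiece₁ hg).map refl3.continuous).trans ((vPiece₂ hg).map refl3.continuous)).trans
    (((vPiece₃ hg).map refl3.continuous).trans ((vPiece₄ hg).map refl3.continuous)))
    (VanKampen.trans_mem (VanKampen.trans_mem (map_refl3_mem (vPiece₁_mem hg) hg) (map_refl3_mem (vPiece₂_mem hg) hg))
      (VanKampen.trans_mem (map_refl3_mem (vPiece₃_mem hg) hg) (map_refl3_mem (vPiece₄_mem hg) hg)))) _).cast _ _ = _
  have m1 := map_refl3_mem (vPiece₁_mem hg) hg
  have m2 := map_refl3_mem (vPiece₂_mem hg) hg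
  have m3 := map_refl3_mem (vPiece₃_mem hg) hg
  have m4 := map_refl3_mem (vPiece₄_mem hg) hg
  rw [cl_emap_trans hg _ _ (VanKampen.trans_mem m1 m2) (VanKampen.trans_mem m3 m4), cl_emap_trans hg _ _ m1 m2,
    cl_emap_trans hg _ _ m3 m4, cl_emap_map_refl3 hg _ (vPiece₁_mem hg), cl_emap_map_refl3 hg _ (vPiece₂_mem hg),
    cl_emap_map_refl3 hg _ (vPiece₃_mem hg), cl_emap_map_refl3 hg _ (vPiece₄_mem hg),
    cl_refl3_emap_vPiece₁, cl_refl3_emap_vPiece₂, cl_refl3_emap_vPiece₃, cl_refl3_emap_vPiece₄]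
  simp only [cast_trans_cast, Path.Homotopic.Quotient.cast_cast]

/-- The word of the four-piece arc under the end map: `x u d⁻¹ x⁻¹` (cast). [folklore] -/
theorem cl_emap_vFourC (hg : 2 ≤ g) (h' : ∀ t, emap hg (vFourC hg) (vFourC_mem hg) t ∈ sectorZ g) :
    cl (emap hg (vFourC hg) (vFourC_mem hg)) h' =
      (((atomX hg).trans (atomU hg)).trans ((atomD hg).symm.trans (atomX hg).symm)).cast
        (Subtype.ext (endMap_top hg)) (Subtype.ext (endMap_bot hg)) := by
  show cl (emap hg ((vFour hg).cast (vArcFun_zero hg).symm (vArcFun_two_mul hg).symm) (vFourC_mem hg)) h' = _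
  rw [cl_emap_cast hg (vFour hg) (vFour_mem hg)]
  show (cl (emap hg (((vPiece₁ hg).trans (vPiece₂ hg)).trans ((vPiece₃ hg).trans (vPiece₄ hg)))
    (VanKampen.trans_mem (VanKampen.trans_mem (vPiece₁_mem hg) (vPiece₂_mem hg))
      (VanKampen.trans_mem (vPiece₃_mem hg) (vPiece₄_mem hg)))) _).cast _ _ = _
  rw [cl_emap_trans hg _ _ (VanKampen.trans_mem (vPiece₁_mem hg) (vPiece₂_mem hg)) (VanKampen.trans_mem (vPiece₃_mem hg) (vPiece₄_mem hg)),
    cl_emap_trans hg _ _ (vPiece₁_mem hg) (vPiece₂_mem hg), cl_emap_trans hg _ _ (vPiece₃_mem hg) (vPiece₄_mem hg),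
    cl_emap_vPiece₁, cl_emap_vPiece₂, cl_emap_vPiece₃, cl_emap_vPiece₄]
  simp only [cast_trans_cast, Path.Homotopic.Quotient.cast_cast]

/-- **The boundary loop at `P`**: `γ⁻¹ · (δ₋ · δ₊⁻¹) · γ` with the valley arcs in four-piece form. [folklore] -/
def bigLoop (hg : 2 ≤ g) : Path (ptP g) (ptP g) :=
  (gam hg).symm.trans (((vFourR hg).trans (vFourC hg).symm).trans (gam hg))

/-- Bookkeeping for the boundary-word computation (`bigLoop_mem`). [folklore] -/
theorem bigLoop_mem (hg : 2 ≤ g) (t : I) : bigLoop hg t ∈ sectorZ g :=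
  VanKampen.trans_mem (VanKampen.symm_mem (gam_mem hg))
    (VanKampen.trans_mem (VanKampen.trans_mem (vFourR_mem hg) (VanKampen.symm_mem (vFourC_mem hg))) (gam_mem hg)) t

/-- **The boundary loop read through the end map**: `x⁻¹ · (y u d⁻¹ y⁻¹) · (x u d⁻¹ x⁻¹)⁻¹ · x`. [folklore] -/
theorem cl_emap_bigLoop (hg : 2 ≤ g)
    (H : ∀ t, (emap hg (bigLoop hg) (bigLoop_mem hg)).cast (endMap_ptP hg).symm (endMap_ptP hg).symm t ∈ sectorZ g) :
    cl ((emap hg (bigLoop hg) (bigLoop_mem hg)).cast (endMap_ptP hg).symm (endMap_ptP hg).symm) H =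
      (atomX hg).symm.trans
        (((((atomY hg).trans (atomU hg)).trans ((atomD hg).symm.trans (atomY hg).symm)).trans
          (((atomX hg).trans (atomU hg)).trans ((atomD hg).symm.trans (atomX hg).symm)).symm).trans (atomX hg)) := by
  rw [cl_cast_split _ (emap_mem hg (bigLoop hg) (bigLoop_mem hg))]
  show (cl (emap hg ((gam hg).symm.trans (((vFourR hg).trans (vFourC hg).symm).trans (gam hg)))
    (VanKampen.trans_mem (VanKampen.symm_mem (gam_mem hg))
      (VanKampen.trans_mem (VanKampen.trans_mem (vFourR_mem hg) (VanKampen.symm_mem (vFourC_mem hg))) (gam_mem hg)))) _).cast _ _ = _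
  rw [cl_emap_trans hg _ _ (VanKampen.symm_mem (gam_mem hg))
      (VanKampen.trans_mem (VanKampen.trans_mem (vFourR_mem hg) (VanKampen.symm_mem (vFourC_mem hg))) (gam_mem hg)),
    cl_emap_symm hg _ (gam_mem hg),
    cl_emap_trans hg _ _ (VanKampen.trans_mem (vFourR_mem hg) (VanKampen.symm_mem (vFourC_mem hg))) (gam_mem hg),
    cl_emap_trans hg _ _ (vFourR_mem hg) (VanKampen.symm_mem (vFourC_mem hg)),
    cl_emap_symm hg _ (vFourC_mem hg), cl_emap_gam, cl_emap_vFourR, cl_emap_vFourC]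
  simp only [symm_cast, cast_trans_cast, Path.Homotopic.Quotient.cast_cast, cast_eq_self]

/-! ### §10 The arc loops, read as atoms -/

/-- The centre of the parameter interval. [folklore] -/
def ctr : closedBall (0 : ℝ) 1 := ⟨0, by simp⟩

/-- The first half of the core: from the right end point `1` to the centre. [folklore] -/
def hIn : Path ptPlus ctr where
  toFun t := ⟨1 - (t : ℝ), by
    rw [mem_closedBall, dist_zero_right, Real.norm_eq_abs, abs_le]
    constructor <;> linarith [t.2.1, t.2.2]⟩
  continuous_toFun := by
    refine Continuous.subtype_mk (by fun_prop) _
  source' := Subtype.ext (by simp [ptPlus])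
  target' := Subtype.ext (by simp [ctr])

/-- The second half of the core: from the centre to the left end point `-1`. [folklore] -/
def hOut : Path ctr ptMinus where
  toFun t := ⟨-(t : ℝ), by
    rw [mem_closedBall, dist_zero_right, Real.norm_eq_abs, abs_le]
    constructor <;> linarith [t.2.1, t.2.2]⟩
  continuous_toFun := by
    refine Continuous.subtype_mk (by fun_prop) _
  source' := Subtype.ext (by simp [ctr])
  target' := Subtype.ext (by simp [ptMinus])

/-- Bookkeeping for the boundary-word computation (`hIn_apply`). [folklore] -/
theorem hIn_apply (t : I) : (hIn t : ℝ) = 1 - t := rfl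
/-- Bookkeeping for the boundary-word computation (`hOut_apply`). [folklore] -/
theorem hOut_apply (t : I) : (hOut t : ℝ) = -t := rfl

/-- The core of the arcs: from `1` to `-1` through the centre, in two halves. [folklore] -/
def hh : Path ptPlus ptMinus := hIn.trans hOut

/-- **The arc loops at `P` used for the free basis**: `α⁺ · (arc run backwards, in two halves) · (α⁻)⁻¹`. [folklore] -/
def loopR (hg : 2 ≤ g) (i : surfaceGen 1) : Path (ptP g) (ptP g) :=
  ((apprPlus hg i).trans (hh.map (arcs hg i).continuous)).trans (apprMinus hg i).symm

/-- Bookkeeping for the boundary-word computation (`loopR_mem`). [folklore] -/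
theorem loopR_mem (hg : 2 ≤ g) (i : surfaceGen 1) (t : I) : loopR hg i t ∈ ballArcs' g hg :=
  arcLoop_mem_union_iUnion (B := range (tipChart hg)) (A := fun j => range (arcs hg j)) i (apprPlus hg i)
    (hh.map (arcs hg i).continuous) (apprMinus hg i) (apprPlus_mem_range hg i) (fun _ => mem_range_self _)
    (apprMinus_mem_range hg i) t

/-- Bookkeeping for the boundary-word computation (`loopR_mem_sectorZ`). [folklore] -/
theorem loopR_mem_sectorZ (hg : 2 ≤ g) (i : surfaceGen 1) (t : I) : loopR hg i t ∈ sectorZ g :=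
  ballArcs'_subset_sectorZ hg (loopR_mem hg i t)

/-- **The free basis of `π₁(sector, P)` on the arc loops `loopR`** (Hatcher, Example 1.22 via
`BallWithArcsBasis.exists_mulEquiv_apply_of_eq_arcLoop`, with core `hh`). [cite: HatcherAT2002, Example 1.22 (p. 43), Prop. 1.17] -/
theorem exists_basis_loopR (hg : 2 ≤ g) :
    ∃ e : FreeGroup (surfaceGen 1) ≃* FundamentalGroup ↥(sectorZ g) ⟨ptP g, ptP_mem_sectorZ hg⟩,
      ∀ i, e (FreeGroup.of i) = FundamentalGroup.fromPath (cl (loopR hg i) (loopR_mem_sectorZ hg i)) := by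
  haveI : Fact ((0 : ℝ) < 1) := ⟨one_pos⟩
  obtain ⟨e₁, he₁⟩ := exists_mulEquiv_apply_of_eq_arcLoop (Z := 𝔼 3) (F := ℝ × ℝ) (E := fun _ : surfaceGen 1 => ℝ)
    (tipChart hg) (injective_tipChart hg) (fun _ => Module.finrank_self ℝ) (arcs hg) (arcs_mem_range_iff hg)
    (injective_arcs hg) (pairwise_disjoint_arcs hg) endPlus endMinus (fun _ => by simp [ptPlus])
    (fun _ => by simp [ptMinus, ptPlus]) (fun _ => hh) (ptP_mem_range_tipChart hg)
    (apprPlus hg) (apprPlus_mem_range hg) (apprMinus hg) (apprMinus_mem_range hg)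
  set e₂ := MulEquiv.ofBijective _ (bijective_inclHom_ballArcs'_sectorZ hg)
  refine ⟨e₁.trans e₂, fun i => ?_⟩
  rw [MulEquiv.trans_apply, he₁ i]
  exact VanKampen.inclHomOfSubset_fromPath_liftPath (ballArcs'_subset_sectorZ hg) (ptP_mem_ballArcs' hg)
    (ballArcs'_subset_sectorZ hg (ptP_mem_ballArcs' hg)) _ _

/-- Parameters with `|x| ≤ 1`. [folklore] -/
theorem abs_one_sub_le (t : I) : |1 - (t : ℝ)| ≤ 1 := abs_le.2 ⟨by linarith [t.2.2], by linarith [t.2.1]⟩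
/-- Bookkeeping for the boundary-word computation (`abs_neg_le`). [folklore] -/
theorem abs_neg_le (t : I) : |(-(t : ℝ))| ≤ 1 := by rw [abs_neg, abs_of_nonneg t.2.1]; exact t.2.2

/-- Bookkeeping for the boundary-word computation (`radC_one`). [folklore] -/
theorem radC_one (hg : 2 ≤ g) : radC hg 1 = rtwo g := by simp [radC]
/-- Bookkeeping for the boundary-word computation (`radC_zero`). [folklore] -/
theorem radC_zero (hg : 2 ≤ g) : radC hg 0 = rho3 hg := by simp [radC]
/-- Bookkeeping for the boundary-word computation (`radC_neg_one`). [folklore] -/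
theorem radC_neg_one (hg : 2 ≤ g) : radC hg (-1) = rtwo g := by simp [radC]
/-- Bookkeeping for the boundary-word computation (`radL_one`). [folklore] -/
theorem radL_one (hg : 2 ≤ g) : radL hg 1 = rss hg := by simp [radL]
/-- Bookkeeping for the boundary-word computation (`radL_zero`). [folklore] -/
theorem radL_zero (hg : 2 ≤ g) : radL hg 0 = rho1 hg := by simp [radL]
/-- Bookkeeping for the boundary-word computation (`radL_neg_one`). [folklore] -/
theorem radL_neg_one (hg : 2 ≤ g) : radL hg (-1) = rss hg := by simp [radL]

/-- Bookkeeping for the boundary-word computation (`radA_mem_JC`). [folklore] -/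
theorem radA_mem_JC (hg : 2 ≤ g) (t : I) : radA g t ∈ JC hg :=
  ⟨(radA_mem (by omega) t).1, (radA_mem (by omega) t).2.trans (rtwo_lt_rho3 hg).le⟩
/-- Bookkeeping for the boundary-word computation (`radC_mem_JC`). [folklore] -/
theorem radC_mem_JC (hg : 2 ≤ g) {x : ℝ} (hx : |x| ≤ 1) : radC hg x ∈ JC hg :=
  ⟨(rtwo_mem (g := g) (by omega)).1.le.trans (radC_mem hg hx).1, (radC_mem hg hx).2⟩
/-- Bookkeeping for the boundary-word computation (`radB_mem_JL`). [folklore] -/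
theorem radB_mem_JL (hg : 2 ≤ g) (t : I) : radB hg t ∈ JL hg :=
  ⟨(rho1_lt_rss hg).le.trans (radB_mem hg t).1, (radB_mem hg t).2⟩
/-- Bookkeeping for the boundary-word computation (`radL_mem_JL`). [folklore] -/
theorem radL_mem_JL (hg : 2 ≤ g) {x : ℝ} (hx : |x| ≤ 1) : radL hg x ∈ JL hg :=
  ⟨(radL_mem hg hx).1, (radL_mem hg hx).2.trans (rss_mem hg).2.le⟩

/-- `α⁺` for `a` is a `Cdn`-piece from `7^{1/20g}` to `r₂`. [folklore] -/
theorem isParamOn_apprPlus_a (hg : 2 ≤ g) : IsParamOn (CdnC g) (JC hg) (apprPlus hg (0, false)) (rt g 7) (rtwo g) := by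
  refine isParamOn_of_forall (fun t => radA g t) (by unfold radA; fun_prop) (radA_mem_JC hg) (fun t => ?_) (by simp [radA]) (by simp [radA])
  show lift (ax (radA g t)) + ((-1 : ℝ) * Real.sqrt (level g - prof g (radA g t))) • ez = Cdn g (radA g t)
  rw [Cdn, lowerPt, flower_ax', neg_one_mul]

/-- `α⁻` for `a` is a `Cup`-piece from `7^{1/20g}` to `r₂`. [folklore] -/
theorem isParamOn_apprMinus_a (hg : 2 ≤ g) : IsParamOn (CupC g) (JC hg) (apprMinus hg (0, false)) (rt g 7) (rtwo g) := by
  refine isParamOn_of_forall (fun t => radA g t) (by unfold radA; fun_prop) (radA_mem_JC hg) (fun t => ?_) (by simp [radA]) (by simp [radA])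
  show lift (ax (radA g t)) + ((1 : ℝ) * Real.sqrt (level g - prof g (radA g t))) • ez = Cup g (radA g t)
  rw [Cup, upperPt, flower_ax', one_mul]

/-- The first half of the reversed `C₁`-arc is a `Cdn`-piece from `r₂` to `ρ₃`. [folklore] -/
theorem isParamOn_hIn_a (hg : 2 ≤ g) : IsParamOn (CdnC g) (JC hg) (hIn.map (arcs hg (0, false)).continuous) (rtwo g) (rho3 hg) := by
  refine isParamOn_of_forall (fun t => radC hg (1 - t)) ((continuous_radC hg).comp (by fun_prop))
    (fun t => radC_mem_JC hg (abs_one_sub_le t)) (fun t => ?_) (by simp [radC_one]) (by simp [radC_zero])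
  show arcCFun hg (1 - (t : ℝ)) = Cdn g (radC hg (1 - t))
  rw [arcCFun_of_ge hg (sub_nonneg.2 t.2.2), htC, Cdn, lowerPt, flower_ax']

/-- The second half of the reversed `C₁`-arc is a `Cup`-piece from `ρ₃` to `r₂`. [folklore] -/
theorem isParamOn_hOut_a (hg : 2 ≤ g) : IsParamOn (CupC g) (JC hg) (hOut.map (arcs hg (0, false)).continuous) (rho3 hg) (rtwo g) := by
  refine isParamOn_of_forall (fun t => radC hg (-t)) ((continuous_radC hg).comp (by fun_prop))
    (fun t => radC_mem_JC hg (abs_neg_le t)) (fun t => ?_) (by simp [radC_zero]) (by simp [radC_neg_one])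
  show arcCFun hg (-(t : ℝ)) = Cup g (radC hg (-t))
  rw [arcCFun_of_le hg (neg_nonpos.2 t.2.1), htC, Cup, upperPt, flower_ax']

/-- `α⁺` for `b` is an `Ldn`-piece from `7^{1/20g}` to `r⋆⋆`. [folklore] -/
theorem isParamOn_apprPlus_b (hg : 2 ≤ g) : IsParamOn (LdnC hg) (JL hg) (apprPlus hg (0, true)) (rt g 7) (rss hg) := by
  refine isParamOn_of_forall (fun t => radB hg t) (by unfold radB; fun_prop) (radB_mem_JL hg) (fun t => ?_) (by simp [radB]) (by simp [radB])
  have h0 : 0 ≤ radB hg t := (rho1_pos hg).le.trans (radB_mem_JL hg t).1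
  show lift (pol (radB hg t) ((-1 : ℝ) * thlo g (radB hg t))) = Ldn g (radB hg t)
  rw [Ldn_of_nonneg h0, neg_one_mul]

/-- `α⁻` for `b` is an `Lup`-piece from `7^{1/20g}` to `r⋆⋆`. [folklore] -/
theorem isParamOn_apprMinus_b (hg : 2 ≤ g) : IsParamOn (LupC hg) (JL hg) (apprMinus hg (0, true)) (rt g 7) (rss hg) := by
  refine isParamOn_of_forall (fun t => radB hg t) (by unfold radB; fun_prop) (radB_mem_JL hg) (fun t => ?_) (by simp [radB]) (by simp [radB])
  have h0 : 0 ≤ radB hg t := (rho1_pos hg).le.trans (radB_mem_JL hg t).1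
  show lift (pol (radB hg t) ((1 : ℝ) * thlo g (radB hg t))) = Lup g (radB hg t)
  rw [Lup_of_nonneg h0, one_mul]

/-- The first half of the reversed lens arc is an `Ldn`-piece from `r⋆⋆` to `ρ₁`. [folklore] -/
theorem isParamOn_hIn_b (hg : 2 ≤ g) : IsParamOn (LdnC hg) (JL hg) (hIn.map (arcs hg (0, true)).continuous) (rss hg) (rho1 hg) := by
  refine isParamOn_of_forall (fun t => radL hg (1 - t)) ((continuous_radL hg).comp (by fun_prop))
    (fun t => radL_mem_JL hg (abs_one_sub_le t)) (fun t => ?_) (by simp [radL_one]) (by simp [radL_zero])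
  have h0 : 0 ≤ radL hg (1 - t) := (rho1_pos hg).le.trans (radL_mem_JL hg (abs_one_sub_le t)).1
  show arcLFun hg (1 - (t : ℝ)) = Ldn g (radL hg (1 - t))
  rw [arcLFun_of_ge hg (sub_nonneg.2 t.2.2), Ldn_of_nonneg h0]

/-- The second half of the reversed lens arc is an `Lup`-piece from `ρ₁` to `r⋆⋆`. [folklore] -/
theorem isParamOn_hOut_b (hg : 2 ≤ g) : IsParamOn (LupC hg) (JL hg) (hOut.map (arcs hg (0, true)).continuous) (rho1 hg) (rss hg) := by
  refine isParamOn_of_forall (fun t => radL hg (-t)) ((continuous_radL hg).comp (by fun_prop))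
    (fun t => radL_mem_JL hg (abs_neg_le t)) (fun t => ?_) (by simp [radL_zero]) (by simp [radL_neg_one])
  have h0 : 0 ≤ radL hg (-t) := (rho1_pos hg).le.trans (radL_mem_JL hg (abs_neg_le t)).1
  show arcLFun hg (-(t : ℝ)) = Lup g (radL hg (-t))
  rw [arcLFun_of_le hg (neg_nonpos.2 t.2.1), Lup_of_nonneg h0]

/-- Memberships of the four pieces of an arc loop. [folklore] -/
theorem apprPlus_mem_sectorZ (hg : 2 ≤ g) (i : surfaceGen 1) (t : I) : apprPlus hg i t ∈ sectorZ g :=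
  ballArcs'_subset_sectorZ hg (Or.inl (apprPlus_mem_range hg i t))
/-- Bookkeeping for the boundary-word computation (`apprMinus_mem_sectorZ`). [folklore] -/
theorem apprMinus_mem_sectorZ (hg : 2 ≤ g) (i : surfaceGen 1) (t : I) : apprMinus hg i t ∈ sectorZ g :=
  ballArcs'_subset_sectorZ hg (Or.inl (apprMinus_mem_range hg i t))
/-- Bookkeeping for the boundary-word computation (`arcs_mem_sectorZ`). [folklore] -/
theorem arcs_mem_sectorZ (hg : 2 ≤ g) (i : surfaceGen 1) (x : closedBall (0 : ℝ) 1) : arcs hg i x ∈ sectorZ g :=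
  ballArcs'_subset_sectorZ hg (Or.inr (mem_iUnion.2 ⟨i, x, rfl⟩))
/-- Bookkeeping for the boundary-word computation (`hIn_map_mem`). [folklore] -/
theorem hIn_map_mem (hg : 2 ≤ g) (i : surfaceGen 1) (t : I) : hIn.map (arcs hg i).continuous t ∈ sectorZ g :=
  arcs_mem_sectorZ hg i _
/-- Bookkeeping for the boundary-word computation (`hOut_map_mem`). [folklore] -/
theorem hOut_map_mem (hg : 2 ≤ g) (i : surfaceGen 1) (t : I) : hOut.map (arcs hg i).continuous t ∈ sectorZ g :=
  arcs_mem_sectorZ hg i _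

/-- **Splitting an arc loop into its two runs**:
`[α⁺ · (h₁ · h₂)∘Φ · (α⁻)⁻¹] = [α⁺ · h₁∘Φ] · [h₂∘Φ · (α⁻)⁻¹]`. [folklore] -/
theorem cl_loopR_split (hg : 2 ≤ g) (i : surfaceGen 1) (H : ∀ t, loopR hg i t ∈ sectorZ g) :
    cl (loopR hg i) H =
      (cl ((apprPlus hg i).trans (hIn.map (arcs hg i).continuous))
          (VanKampen.trans_mem (apprPlus_mem_sectorZ hg i) (hIn_map_mem hg i))).trans
        (cl ((hOut.map (arcs hg i).continuous).trans (apprMinus hg i).symm)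
          (VanKampen.trans_mem (hOut_map_mem hg i) (VanKampen.symm_mem (apprMinus_mem_sectorZ hg i)))) := by
  have e : loopR hg i = ((apprPlus hg i).trans ((hIn.map (arcs hg i).continuous).trans (hOut.map (arcs hg i).continuous))).trans
      (apprMinus hg i).symm := by
    rw [loopR, hh, Path.map_trans]
  rw [cl_congr e H (VanKampen.trans_mem (VanKampen.trans_mem (apprPlus_mem_sectorZ hg i)
    (VanKampen.trans_mem (hIn_map_mem hg i) (hOut_map_mem hg i))) (VanKampen.symm_mem (apprMinus_mem_sectorZ hg i)))]
  simp only [cl_trans_split, cl_symm_split, Path.Homotopic.Quotient.trans_assoc]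

/-- **The loop `a` reads `d · u⁻¹`.** [folklore] -/
theorem cl_loopR_a (hg : 2 ≤ g) (H : ∀ t, loopR hg (0, false) t ∈ sectorZ g) :
    cl (loopR hg (0, false)) H = (atomD hg).trans (atomU hg).symm := by
  rw [cl_loopR_split,
    cl_eq_atomD hg _ ((isParamOn_apprPlus_a hg).trans (isParamOn_hIn_a hg)) rfl
      (by rw [(isParamOn_hIn_a hg).target_eq, CdnC_apply, Cdn_rho3]),
    cl_eq_atomU_symm hg _ ((isParamOn_hOut_a hg).trans (isParamOn_apprMinus_a hg).symm)
      (by rw [(isParamOn_hOut_a hg).source_eq, CupC_apply, Cup_rho3]) rfl]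
  simp only [cast_trans_cast, cast_eq_self]

/-- **The loop `b` reads `y⁻¹ · x`.** [folklore] -/
theorem cl_loopR_b (hg : 2 ≤ g) (H : ∀ t, loopR hg (0, true) t ∈ sectorZ g) :
    cl (loopR hg (0, true)) H = (atomY hg).symm.trans (atomX hg) := by
  rw [cl_loopR_split,
    cl_eq_atomY_symm hg _ ((isParamOn_apprPlus_b hg).trans (isParamOn_hIn_b hg)) rfl
      (by rw [(isParamOn_hIn_b hg).target_eq, LdnC_apply, Ldn_rho1]),
    cl_eq_atomX hg _ ((isParamOn_hOut_b hg).trans (isParamOn_apprMinus_b hg).symm)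
      (by rw [(isParamOn_hOut_b hg).source_eq, LupC_apply, Lup_rho1]) rfl]
  simp only [cast_trans_cast, cast_eq_self]

/-! ### §11 The boundary word and the basis at the pole -/

/-- **The two readings agree**: `ℓ_b⁻¹ · ℓ_a⁻¹ · ℓ_b · ℓ_a` equals the end-map reading of the
boundary loop (both are `x⁻¹ y u d⁻¹ y⁻¹ x d u⁻¹`). [folklore] -/
theorem word_agree (hg : 2 ≤ g) (Ha : ∀ t, loopR hg (0, false) t ∈ sectorZ g) (Hb : ∀ t, loopR hg (0, true) t ∈ sectorZ g)
    (H : ∀ t, (emap hg (bigLoop hg) (bigLoop_mem hg)).cast (endMap_ptP hg).symm (endMap_ptP hg).symm t ∈ sectorZ g) :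
    (cl (loopR hg (0, true)) Hb).symm.trans ((cl (loopR hg (0, false)) Ha).symm.trans
      ((cl (loopR hg (0, true)) Hb).trans (cl (loopR hg (0, false)) Ha))) =
    cl ((emap hg (bigLoop hg) (bigLoop_mem hg)).cast (endMap_ptP hg).symm (endMap_ptP hg).symm) H := by
  rw [cl_loopR_a, cl_loopR_b, cl_emap_bigLoop]
  simp only [quot_symm_trans, quot_symm_symm, Path.Homotopic.Quotient.trans_assoc,
    Path.Homotopic.Quotient.symm_trans, Path.Homotopic.Quotient.trans_refl]

/-- The upper pole lies in the sector. [folklore] -/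
theorem top_mem_sectorZ (hg : 2 ≤ g) : top g ∈ sectorZ g := (vArc hg).source ▸ vArc_mem_sectorZ hg 0

/-- The genus-one surface relator is `a b a⁻¹ b⁻¹` on the generators `(0, false)`, `(0, true)`. [folklore] -/
theorem surfaceRelator_one_eq :
    surfaceRelator 1 = FreeGroup.of ((0 : Fin 1), false) * FreeGroup.of ((0 : Fin 1), true) *
      (FreeGroup.of ((0 : Fin 1), false))⁻¹ * (FreeGroup.of ((0 : Fin 1), true))⁻¹ := by
  rw [surfaceRelator_one]; rfl

/-- **The boundary word of a sector.**  There is a free basis `θ : F⟨a, b⟩ ≅ π₁(sector, 0⁺)` of the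
fundamental group of the sector of the flower surface at the upper pole in which the boundary loop
"down the valley arc over `θ = -π/g`, up the valley arc over `θ = π/g`" reads `a b a⁻¹ b⁻¹`:
`θ(r₁) = [δ₋ · δ₊⁻¹]` (Hatcher, §1.2 p. 51: the boundary circle of a one-holed torus is the
commutator of the free basis).  Proof: the free basis at the lens tip `P` on the reversed arc loops
(`exists_basis_loopR`), moved to the pole along `γ`; the boundary loop conjugated by `γ` is read
through the explicit retraction of the sector onto its reduced spine (`fromPath_cl_eq_emap`,
`cl_emap_bigLoop`) and compared with the commutator of the arc loops (`word_agree`).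
[cite: HatcherAT2002, §1.2 p. 51 and Example 1.22] -/
theorem exists_basis_sectorZ_bdry (hg : 2 ≤ g) :
    ∃ θ : FreeGroup (surfaceGen 1) ≃* FundamentalGroup ↥(sectorZ g) ⟨top g, top_mem_sectorZ hg⟩,
      θ (surfaceRelator 1) =
        bdryClass (sectorZ g) (top_mem_sectorZ hg) (vArc hg) (vArcR hg) (vArc_mem_sectorZ hg) (vArcR_mem hg) := by
  obtain ⟨e, he⟩ := exists_basis_loopR hg
  refine ⟨e.trans (FundamentalGroup.fundamentalGroupMulEquivOfPath
    (VanKampen.liftPath (sectorZ g) (gam hg) (gam_mem hg)).symm), ?_⟩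
  -- the relator as an explicit loop at `P`
  set Wp : Path (⟨ptP g, ptP_mem_sectorZ hg⟩ : ↥(sectorZ g)) ⟨ptP g, ptP_mem_sectorZ hg⟩ :=
    (VanKampen.liftPath (sectorZ g) (loopR hg (0, true)) (loopR_mem_sectorZ hg (0, true))).symm.trans
      ((VanKampen.liftPath (sectorZ g) (loopR hg (0, false)) (loopR_mem_sectorZ hg (0, false))).symm.trans
        ((VanKampen.liftPath (sectorZ g) (loopR hg (0, true)) (loopR_mem_sectorZ hg (0, true))).trans
          (VanKampen.liftPath (sectorZ g) (loopR hg (0, false)) (loopR_mem_sectorZ hg (0, false))))) with hWp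
  have hr : e (surfaceRelator 1) = FundamentalGroup.fromPath (Path.Homotopic.Quotient.mk Wp) := by
    rw [hWp, surfaceRelator_one_eq, map_mul, map_mul, map_mul, map_inv, map_inv, he, he]
    simp only [FundamentalGroup.fromPath, FundamentalGroup.fromArrow, FundamentalGroup.mul_def,
      FundamentalGroup.inv_def, Path.Homotopic.Quotient.mk_trans, Path.Homotopic.Quotient.mk_symm]
  -- `[bigLoop]` split into its pieces (canonical membership proofs)
  have h3 : cl (bigLoop hg) (bigLoop_mem hg) =
      (cl (gam hg) (gam_mem hg)).symm.trans (((cl (vFourR hg) (vFourR_mem hg)).trans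
        (cl (vFourC hg) (vFourC_mem hg)).symm).trans (cl (gam hg) (gam_mem hg))) := by
    rw [cl_symm, cl_symm, cl_trans, cl_trans, cl_trans]
    rfl
  -- the two readings of the relator loop
  have h1 := word_agree hg (loopR_mem_sectorZ hg (0, false)) (loopR_mem_sectorZ hg (0, true))
    (fun t => by rw [Path.cast_coe]; exact emap_mem hg _ _ t)
  have h2 : cl (bigLoop hg) (bigLoop_mem hg) =
      cl ((emap hg (bigLoop hg) (bigLoop_mem hg)).cast (endMap_ptP hg).symm (endMap_ptP hg).symm)
        (fun t => by rw [Path.cast_coe]; exact emap_mem hg _ _ t) :=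
    fromPath_cl_eq_emap hg (bigLoop hg) (bigLoop_mem hg)
  have hW : Path.Homotopic.Quotient.mk Wp =
      (cl (gam hg) (gam_mem hg)).symm.trans (((cl (vFourR hg) (vFourR_mem hg)).trans
        (cl (vFourC hg) (vFourC_mem hg)).symm).trans (cl (gam hg) (gam_mem hg))) := by
    rw [hWp]
    simp only [Path.Homotopic.Quotient.mk_trans, Path.Homotopic.Quotient.mk_symm]
    rw [← h3, h2]
    exact h1
  -- the target loop, split, with the four-piece arcs
  have hT : Path.Homotopic.Quotient.mk (VanKampen.liftPath (sectorZ g) ((vArcR hg).trans (vArc hg).symm)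
      (trans_symm_mem (vArc_mem_sectorZ hg) (vArcR_mem hg))) =
      (cl (vFourR hg) (vFourR_mem hg)).trans (cl (vFourC hg) (vFourC_mem hg)).symm := by
    rw [← cl_vArc_eq, ← cl_vArcR_eq, cl_symm, cl_trans]
  -- assemble
  rw [MulEquiv.trans_apply, hr, VanKampen.fundamentalGroupMulEquivOfPath_fromPath_eq]
  show FundamentalGroup.fromPath _ = FundamentalGroup.fromPath (Path.Homotopic.Quotient.mk
    (VanKampen.liftPath (sectorZ g) ((vArcR hg).trans (vArc hg).symm) (trans_symm_mem (vArc_mem_sectorZ hg) (vArcR_mem hg))))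
  congr 1
  rw [hT, Path.symm_symm, Path.Homotopic.Quotient.mk_trans, Path.Homotopic.Quotient.mk_trans,
    Path.Homotopic.Quotient.mk_symm, hW]
  simp only [Path.Homotopic.Quotient.trans_assoc, VanKampen.trans_symm_cancel, Path.Homotopic.Quotient.trans_symm,
    Path.Homotopic.Quotient.trans_refl]

end FlowerModel

end Literature.Topology.FourManifolds
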